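import Summits.QuantumFields.YangMills.Theorems.BalabanUVNodesN06AtRecord11ObligationsPins
import Summits.QuantumFields.YangMills.Theorems.BalabanUVNodesN06AtRecord11ObligationsHg
import Summits.QuantumFields.YangMills.Theorems.BalabanUVNodesN06SectBOfFrameV3
import Literature.MathematicalPhysics.QuantumFieldTheory.Balaban1983to89.B9Cor35ComparisonsEH
import Literature.MathematicalPhysics.QuantumFieldTheory.Balaban1983to89.B9Ineq344LocalPairHolds
import Literature.MathematicalPhysics.QuantumFieldTheory.Balaban1983to89.B9Ineq347GAAtLetters
import Literature.MathematicalPhysics.QuantumFieldTheory.Balaban1983to89.B9Thm39ReadingAtLetters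
import Literature.MathematicalPhysics.QuantumFieldTheory.Balaban1983to89.B9Thm314Thm315RecordVacuity
import Literature.MathematicalPhysics.QuantumFieldTheory.Balaban1983to89.Node00.OpsYSectDE
import Literature.MathematicalPhysics.QuantumFieldTheory.Balaban1983to89.B9Thm312WholeLeafRelH
import Literature.MathematicalPhysics.QuantumFieldTheory.Balaban1983to89.B9Thm313WholeLeafRel
import Literature.MathematicalPhysics.QuantumFieldTheory.Balaban1983to89.B9Thm312WholeFacesY
import Literature.MathematicalPhysics.QuantumFieldTheory.Balaban1983to89.B9CarrierBlockMultiplicity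
import Literature.MathematicalPhysics.QuantumFieldTheory.Balaban1983to89.B9CoRealizesRelAtLetters
import Literature.MathematicalPhysics.QuantumFieldTheory.Balaban1983to89.B9Ineq349SiteReading
import Literature.MathematicalPhysics.QuantumFieldTheory.Balaban1983to89.B9Eq3132AtRecordDE
import Literature.MathematicalPhysics.QuantumFieldTheory.Balaban1983to89.B9Thm314Thm315RecordDE
import Literature.MathematicalPhysics.QuantumFieldTheory.Balaban1983to89.B9Thm311ReadingAtLetters
import Literature.MathematicalPhysics.QuantumFieldTheory.Balaban1983to89.B9RWSumsDefinitePinsNbr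
import Literature.MathematicalPhysics.QuantumFieldTheory.Balaban1983to89.B9CoReadingCoordsGlob
import Literature.MathematicalPhysics.QuantumFieldTheory.Balaban1983to89.B9CoReadingCoordsS
import Literature.MathematicalPhysics.QuantumFieldTheory.Balaban1983to89.B9Ineq349SiteFromBlocks
import Literature.MathematicalPhysics.QuantumFieldTheory.Balaban1983to89.Node00.OpsYRecordV4
import Literature.MathematicalPhysics.QuantumFieldTheory.Balaban1983to89.B9Thm315WholeSectERepOn

/-!
# BalabanUVNodes ∕ N06 ([B9], `Dag.B9_main`) — THE STAGE-11 CERTIFICATE AT def-Y's v4 INSTANCE `opsYOfRecordV4E` WITH EVERY (3.42)∕(3.47) CO-READING OF ROWS 18–21 PROVED: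
# the κ-fold coordinate pins on BOTH sectors (bond: `B9CoReadingCoords(Glob)` p498421∕p501046; site: `B9CoReadingCoordsS`)

Track A of `YM-PLAN.md` (cell `pub-ymgap`, HUMAN RULING D-0062), node **N06** = [Balaban1985BackgroundPropagators] Thms 3.1–3.15; seat `pub-ymgap-dag-n06-d` gen 5.
The 28-row composition `N06AtRecord11CB10YZW.b9_main_of_up_view₁₁B10YZW_of_obligations` at `opsYOfRecordV4E N θ₃ M⋆ 𝔯 𝔢 𝔴 𝔈` (def-Y `Node00/OpsYRecordV4`; letters
`𝔏 = lettersYOfRecordV4`, E-sector section `𝔢`, its walk reading `𝔴`, exponents `𝔈`), every row supplied by a named face: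
* rows 13∕18∕19 ⇐ n06-k g8's Nbr face `B9RWSumsDefinitePinsNbr.rows131819_definite_geo9Y_nbr` ((3.46)∕(3.43)∕input co-readings in the radius-2 species `L2ReadsNbr ∕
  H1ReadsNbr ∕ InputReadsNbr`, constant `Cev`, displayed binders `mN Cev hCev hnbr` — the Rel species is refuted at pinned evaluations, n06-k `not_l2ReadsRel_evBK`);
  the G′ walk letters `𝔬 rd 𝔭 bH` live on the SITE carrier `XSK κK x.toKIdx = SiteY × Fin (d+1) × κ × κ` and the G walk letters `𝔬A …` on the BOND carrier
  `XBK κK x.toKIdx`, block maps pinned through the faithful `bI` (`hblkS hblkYS` via `sIK`, `hblkA hblkYA`), model operators pinned to the coordinate models of the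
  GENUINE letters `(𝔏 x).Gp` (`hGpS hDS hDsS hLapS` → `GcoS DcoS DscoS LcoS`) and `(𝔏 x).GA` (`hGcoA hDcoA hDscoA hLcoA` → `GcoK DcoK DscoK LcoK`), evaluations
  `evSK ∕ evBK`; the sixteen co-readings `hco0‥3 hgl0‥3 hcoA0‥3 hglA0‥3` are PROVED (`site_coReadings_of_pins`, `B9CoReadingCoords(Glob∕S)`);
* rows 20–21 ⇐ n06-l `thm312Printed_of_stepRelH` ∕ `thm313Printed_of_stepRel` with the Thm-3.12∕3.13 walk letters `𝔬12` on `XBK κK x.toKIdx` pinned (`hblk12 … hDsco12`),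
  the thirteen co-readings `hcoR12 hco1R12 hcoR13 hco1R13 hcoG12 hcoG13` PROVED; rows 22–23 ⇐ n06-m `thm314_pair_layerOfLetters`; row 24 ⇐ n06-m g4's face of
  record `B9Thm315WholeSectERepOn.t315_opsYOfRecordV4E_of_3185_on` (Thm 3.15 through the (3.185) SLOT: identity + expansion clause + outer locality + decay of `QG̃₂Q*`
  between Λ-bonds ⇒ (3.187) DERIVED; one schema `hE`, five numerics); row 25 ⇐ n06-i `stmt349Printed_site_of_blockSchemas 𝔏 h31S h32B`; row 17 ⇐ n06-j; ROW 11 WITH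
  NO BINDER (n06-h g5 `B9Ineq344LocalPairHolds.hGp_opsYOfLetters_holds`: the located residual schema of (3.44)∕(3.45) at U = 1 is a theorem, p508439); ROW 13 from ONE
  `F : SectBFrame₃ …` (n06-c g4's frame of record, `N06SectBOfFrameV3.hB_obligation_of_sectBFrame₃`, p508689); Cor. 3.5 comparisons and `hg` as in the earlier certificates;
* ROW 26 DISPLAYED WHOLE as `s3132 : B9.Stmt3132Printed … (·).QGQinv (·).QG1Qinv` — LOCATED FALSE AS INSTANTIATED (n06-i g7, `B9Eq3132FlatReadingAtOne`: (3.132) read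
  through the FLAT `siteKernelOfOp` of `(QGQ*)⁻¹` fails at U = 1 by unbounded powers of Lᵏ, a units defect of the reading): THIS CERTIFICATE IS CONDITIONAL ON A
  LOCATED-FALSE ROW until def-Y's weighted reading of `QGQinv ∕ QG1Qinv` lands (re-instantiation + n06-i's re-derived face); displayed whole so that nothing is derived ex
  falso from estimate binders.
Still displayed: the `L2ReadsNbr ∕ H1ReadsNbr ∕ InputReadsNbr` binders, `mN Cev hnbr`, `hcoHR12` ((3.133)), `s3132`, every walk-expansion schema.
HONEST FRAMING.  Kernel bookkeeping; COUNT-NEUTRAL; NOT a discharge claim (Theorem 3.1's estimates for Bałaban's operators at U ≠ 1 are nowhere proved — they are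
the displayed walk-expansion schemas, now ABOUT the genuine operators in real coordinates); N06 NOT discharged.  One finite 𝕋⁴ programme at fixed `ε` — NOT ℝ⁴ ∕ OS ∕
mass gap ∕ Clay.  0 `def`, 0 `sorry`.
-/

noncomputable section

namespace Summit.QuantumFields.YangMills.BalabanUVNodes.N06AtOpsYOfRecordV4ECoordsS

open Literature.MathematicalPhysics.QuantumFieldTheory.Balaban1983to89 open Literature.MathematicalPhysics.QuantumFieldTheory.Balaban1983to89.T4Continuum (T4Family) open Literature.MathematicalPhysics.QuantumFieldTheory.Balaban1983to89.DagBinding (WorldP leavesP) open Literature.MathematicalPhysics.QuantumFieldTheory.Balaban1983to89.Node00 open Literature.MathematicalPhysics.QuantumFieldTheory.Balaban1983to89.B9PinMembersKLevelV1 (MemberY geo9Y bg9Y) open Literature.MathematicalPhysics.QuantumFieldTheory.Balaban1983to89.B9PinGeometryKLevelV1 (dOmegaY OmKY inΛY unitDistY InCubeY c35Y c35Y_pos) open Literature.MathematicalPhysics.QuantumFieldTheory.Balaban1983to89.B7Prop2SpecialUnitary (specialUnitaryUnits) open Literature.MathematicalPhysics.QuantumFieldTheory.Balaban1983to89.B9Ineq347GAAtLetters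 (hGA_opsYOfLetters) open Literature.MathematicalPhysics.QuantumFieldTheory.Balaban1983to89.B9Ineq344LocalPairHolds (hGp_opsYOfLetters_holds) open Literature.MathematicalPhysics.QuantumFieldTheory.Balaban1983to89.B9Cor35ComparisonsGAAtLetters
  (hGA_e_opsYOfLetters hGA_h1_opsYOfLetters hGA_e4_opsYOfLetters hGA_h2_opsYOfLetters hGA_l2_opsYOfLetters)
open Literature.MathematicalPhysics.QuantumFieldTheory.Balaban1983to89.B9Cor35ComparisonsGpCAtLetters (hGp_e_opsYOfLetters hGp_h1_opsYOfLetters hC_opsYOfLetters) open Literature.MathematicalPhysics.QuantumFieldTheory.Balaban1983to89.B9Cor35ComparisonsEH (hE4_of_hGA_e4 hH2_of_hGA_h2) open Literature.MathematicalPhysics.QuantumFieldTheory.Balaban1983to89.B9Thm314Thm315RecordVacuity (thm315FullPrinted_of_ker_zero) open Literature.MathematicalPhysics.QuantumFieldTheory.Balaban1983to89.B9RecordDELettersVacuity (siteKernelOfOp_zero_ker fineKernelOfOp_zero_ker stmt349Printed_of_ker_zero) open Literature.MathematicalPhysics.QuantumFieldTheory.Balaban1983to89.B9GeoLemma21KLevelV1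 (geo9Y_len_pos) open Literature.MathematicalPhysics.QuantumFieldTheory.Balaban1983to89.B9Thm311Whole (PosDefOfOps) open Literature.MathematicalPhysics.QuantumFieldTheory.Balaban1983to89.B9Thm39Whole (WalkReading39) open Literature.MathematicalPhysics.QuantumFieldTheory.Balaban1983to89.B9Thm39WholeBlk (Ops39Blk StaticOK39Blk Locality39Blk Local348Blk Identities395Blk Small285Blk Factors389Blk)
open Literature.MathematicalPhysics.QuantumFieldTheory.Balaban1983to89.B9Thm39WholeBlkViaDatum (EK39OfOpsBlkVia) open Literature.MathematicalPhysics.QuantumFieldTheory.Balaban1983to89.B9Thm39ReadingCoords (repSite39) open Literature.MathematicalPhysics.QuantumFieldTheory.Balaban1983to89.B9Thm39ReadingAtLetters (X39 blk39 L39 t39_hksum_of_pins_opsYOfLetters) open Literature.MathematicalPhysics.QuantumFieldTheory.Balaban1983to89.B9RowSum261DefiniteFaces (rowConst261) open Summit.QuantumFields.YangMills.BalabanUVNodes.N06AtRecord11ObligationsPins (t311_of_pin) open Summit.QuantumFields.YangMills.BalabanUVNodes.N06AtRecord11ObligationsHg (hg_obligation_vacuous) open Summit.QuantumFields.YangMills.BalabanUVNodes.N06AtRecord11CB10YZW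 (b9_main_of_up_view₁₁B10YZW_of_obligations) open Literature.MathematicalPhysics.QuantumFieldTheory.Balaban1983to89.B9Thm312Whole (GeoOK Thm33G0 FormSmall HasRWExpOfOps HasRWExpHOfOps PosDefKOfOps) open Literature.MathematicalPhysics.QuantumFieldTheory.Balaban1983to89.B11SectG (RowSum BlockNorm) open Literature.MathematicalPhysics.QuantumFieldTheory.Balaban1983to89.B9FromB6 (L2Block) open Literature.MathematicalPhysics.QuantumFieldTheory.Balaban1983to89.B9Thm312WholeH (LettersH) open Literature.MathematicalPhysics.QuantumFieldTheory.Balaban1983to89.B9Thm312WholeLeft (LeftStep)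
open Literature.MathematicalPhysics.QuantumFieldTheory.Balaban1983to89.B9Thm313WholeLeft (Letters313D) open Literature.MathematicalPhysics.QuantumFieldTheory.Balaban1983to89.B9Thm313Whole (Letters313) open Literature.MathematicalPhysics.QuantumFieldTheory.Balaban1983to89.B9Ineq347CoReading (CoReadsGlob) open Literature.MathematicalPhysics.QuantumFieldTheory.Balaban1983to89.B9Thm312WholeFacesY (lemma21AboveG_geo9Y) open Literature.MathematicalPhysics.QuantumFieldTheory.Balaban1983to89.B9GeoNormsKLevelV1 (geo9K_dist_nonneg) open Literature.MathematicalPhysics.QuantumFieldTheory.Balaban1983to89.B9GeoLemma21KLevelV1 (distOK_geo9Y rowSum261_geo9Y geo9Y_dist_triangle geo9Y_dist_comm) open Literature.MathematicalPhysics.QuantumFieldTheory.Balaban1983to89.B9GeoNormsKLevelModelSignsV1 (modelSignsOn_geo9K) open Literature.MathematicalPhysics.QuantumFieldTheory.Balaban1983to89.B9Thm34Ext (toB6) open Literature.MathematicalPhysics.QuantumFieldTheory.Balaban1983to89.B9CoRealizesRel (CoRealizesRel) open Literature.MathematicalPhysics.QuantumFieldTheory.Balaban1983to89.B9CoRealizesRelAtLetters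 (RelB maj342_relB_left maj342_relB_right dist_eq_of_relB len_eq_of_relB relB_refl)
open Literature.MathematicalPhysics.QuantumFieldTheory.Balaban1983to89.B9CoRealizesHRel (CoRealizesHRel) open Literature.MathematicalPhysics.QuantumFieldTheory.Balaban1983to89.B9SectCDiffDict (maj342) open Literature.MathematicalPhysics.QuantumFieldTheory.Balaban1983to89.B6Ineq2142KLevelV1 (β) open Literature.MathematicalPhysics.QuantumFieldTheory.Balaban1983to89.B9CarrierBlockMultiplicity (card_sameCarrier_le_kIdx) open Literature.MathematicalPhysics.QuantumFieldTheory.Balaban1983to89.B9Thm312WholeLeafRelH (thm312Printed_of_stepRelH) open Literature.MathematicalPhysics.QuantumFieldTheory.Balaban1983to89.B9Thm313WholeLeafRel (thm313Printed_of_stepRel) open Literature.MathematicalPhysics.QuantumFieldTheory.Balaban1983to89.B9Eq3132SectDLetters (QGQY) open Literature.MathematicalPhysics.QuantumFieldTheory.Balaban1983to89.B9Eq3132CTInputs (CoerciveUnder DecayUnder) open Literature.MathematicalPhysics.QuantumFieldTheory.Balaban1983to89.B9Eq3132ScalarIndex (geoComap) open Literature.MathematicalPhysics.QuantumFieldTheory.Balaban1983to89.B9Eq3132RingInverseReading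 (normMatY) open Literature.MathematicalPhysics.QuantumFieldTheory.Balaban1983to89.B9Ineq349SiteReading (opsYS349OfRecordDE) open Literature.MathematicalPhysics.QuantumFieldTheory.Balaban1983to89.B9Eq3132AtRecordDE (s3132_opsYOfRecordDE)
open Literature.MathematicalPhysics.QuantumFieldTheory.Balaban1983to89.B9Thm314Thm315RecordDE (thm314_pair_opsYOfRecordDE t315_opsYOfRecordDE_of_slots) open Literature.MathematicalPhysics.QuantumFieldTheory.Balaban1983to89.B9Thm311ReadingAtLetters (ProofLetters311 Inputs311Y ops311Y t311_of_pins_opsYOfLetters) open Literature.MathematicalPhysics.QuantumFieldTheory.Balaban1983to89.B9PinGeometryKLevelV1 (kLab) open Literature.MathematicalPhysics.QuantumFieldTheory.Balaban1983to89.B9Thm314GpFlatTorusGeometry (tdistK OmegaC) open Literature.MathematicalPhysics.QuantumFieldTheory.Balaban1983to89.B9Thm314WholePinGeometry (locDataY) open Literature.MathematicalPhysics.QuantumFieldTheory.Balaban1983to89.B9Thm314WholePair (locData₂) open Literature.MathematicalPhysics.QuantumFieldTheory.Balaban1983to89.B9Thm314WholePairWalks (pairWalkSets) open Literature.MathematicalPhysics.QuantumFieldTheory.Balaban1983to89.B9Thm314WholeSummation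 (WalkSetsSpec WalkWeightsSummable) open Literature.MathematicalPhysics.QuantumFieldTheory.Balaban1983to89.B9SectCWalkTermsAllNorms (Thm310AllNormsPrinted) open Literature.MathematicalPhysics.QuantumFieldTheory.Balaban1983to89.B9Thm314WholeExpansionReads (ExpansionReads) open Literature.MathematicalPhysics.QuantumFieldTheory.Balaban1983to89.B9Thm314WholeCancellationLayer (pairOp) open Literature.MathematicalPhysics.QuantumFieldTheory.Balaban1983to89.B9Thm37Whole (Ops Sizes StaticOK Local342 Identities)
open Literature.MathematicalPhysics.QuantumFieldTheory.Balaban1983to89.B9Cor38Whole (WalkReading Locality) open Literature.MathematicalPhysics.QuantumFieldTheory.Balaban1983to89.B9Thm310Whole (Ops310 WalkReading310 Sizes310 StaticOK310 Locality310 Local342G Identities310) open Literature.MathematicalPhysics.QuantumFieldTheory.Balaban1983to89.B9RWSumsDefinitePins (PinPrims) open Literature.MathematicalPhysics.QuantumFieldTheory.Balaban1983to89.B9RWSumsDefinitePinsNbr (E37YNbr E310YNbr rows131819_definite_geo9Y_nbr) open Literature.MathematicalPhysics.QuantumFieldTheory.Balaban1983to89.B9Thm37Glue (IsTransposePair) open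 Literature.MathematicalPhysics.QuantumFieldTheory.Balaban1983to89.B9RWSums343to347Whole (GlobReads) open Literature.MathematicalPhysics.QuantumFieldTheory.Balaban1983to89.B9RWSumsReadsNbr (nbr L2ReadsNbr H1ReadsNbr InputReadsNbr) open Literature.MathematicalPhysics.QuantumFieldTheory.Balaban1983to89.B9RWSums346Two (L2TwoLegs310 FactorsL2_310) open Literature.MathematicalPhysics.QuantumFieldTheory.Balaban1983to89.B9RWSums346TwoGp (L2TwoLegs37 FactorsL2_37) open Literature.MathematicalPhysics.QuantumFieldTheory.Balaban1983to89.B9RWSums344Input (InputLegs310 FactorsInput310)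
open Literature.MathematicalPhysics.QuantumFieldTheory.Balaban1983to89.B9RWSums344InputGp (InputLegs37 FactorsInput37) open Literature.MathematicalPhysics.QuantumFieldTheory.Balaban1983to89.B9RWSums343Holder (HolderProbes HolderLegs310 FactorsHolder310) open Literature.MathematicalPhysics.QuantumFieldTheory.Balaban1983to89.B9RWSums343HolderGp (HolderLegs37 HolderV37) open Literature.MathematicalPhysics.QuantumFieldTheory.Balaban1983to89.B9RWSums346Lap (LapLegs310 LapLegs37) open Literature.MathematicalPhysics.QuantumFieldTheory.Balaban1983to89.B9SectBStepFrameV3 (SectBFrame₃) open Summit.QuantumFields.YangMills.BalabanUVNodes.N06SectBOfFrameV3 (hB_obligation_of_sectBFrame₃)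
open Literature.MathematicalPhysics.QuantumFieldTheory.Balaban1983to89.B9CoReadingCoords (XBK evBK blkBK GcoK DcoK DscoK LcoK coRealizesRel_kernelFamilyB_coords_zero coRealizesRel_kernelFamilyB_coords_one coRealizesRel_kernelFamilyB_coords_two coRealizesRel_kernelFamilyB_coords_three) open Literature.MathematicalPhysics.QuantumFieldTheory.Balaban1983to89.B9CoReadingCoordsGlob (coReadsGlob_kernelFamilyB_coords_zero coReadsGlob_kernelFamilyB_coords_one coReadsGlob_kernelFamilyB_coords_two globReads_kernelFamilyB_coords_zero globReads_kernelFamilyB_coords_one globReads_kernelFamilyB_coords_two globReads_kernelFamilyB_coords_three) open Literature.MathematicalPhysics.QuantumFieldTheory.Balaban1983to89.B9CoReadingCoordsS (XSK evSK blkSK sIK sIK_faithful sIK_level GcoS DcoS DscoS LcoS coRealizesRel_kernelFamilyS_coords_zero coRealizesRel_kernelFamilyS_coords_one coRealizesRel_kernelFamilyS_coords_two coRealizesRel_kernelFamilyS_coords_three globReads_kernelFamilyS_coords_zero globReads_kernelFamilyS_coords_one globReads_kernelFamilyS_coords_two globReads_kernelFamilyS_coords_three)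
open Literature.MathematicalPhysics.QuantumFieldTheory.Balaban1983to89.B9Ineq349SiteFromBlocks (Thm31SiteSchemas Thm32BlkSchema stmt349Printed_site_of_blockSchemas) open Literature.MathematicalPhysics.QuantumFieldTheory.Balaban1983to89.B6GlobalChartV1 (blkV1) open Literature.MathematicalPhysics.QuantumFieldTheory.Balaban1983to89.B6Ineq2142KLevelV1 (lvl) open Literature.MathematicalPhysics.QuantumFieldTheory.Balaban1983to89.B9Thm315WholeSectERep (LocalOuterY) open Literature.MathematicalPhysics.QuantumFieldTheory.Balaban1983to89.B9Thm315WholeSectERepOn (DecayMidOnY t315_opsYOfRecordV4E_of_3185_on) open Literature.MathematicalPhysics.QuantumFieldTheory.Balaban1983to89.B9Thm314WholeCancellationLayer (thm314_pair_layerOfLetters) open Literature.MathematicalPhysics.QuantumFieldTheory.Balaban1983to89.B9Thm314WholePinGeometry (locDataY_laws) open Literature.MathematicalPhysics.QuantumFieldTheory.Balaban1983to89.B9PinGeometryKLevelV1 (dOmegaY_nonneg) open scoped Matrix.Norms.L2Operator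

variable {N : ℕ}

section Pointed

variable [NeZero N] {F : T4Family}

omit [NeZero N] in
/-- **ROW 18's EIGHT SITE-SECTOR CO-READINGS UNDER THE SITE PINS** (its own declaration, keeping the certificate inside the default heartbeat budget): for any member `x`, real basis `bK`, carrier- and level-faithful `bI`, ANY site-sector letter `Gp` with transporters `parS`, and Thm-3.7 walk letters `𝔬` on `XSK κK x.toKIdx` pinned to the coordinate models of `Gp`, the four (3.42) co-readings `CoRealizesRel (kernelFamilyS … Gp parS) n U (RelB …) …` and the four (3.47) readings `GlobReads …` HOLD (`B9CoReadingCoordsS`, `sIK_faithful`, `sIK_level`). [cite: Balaban1985BackgroundPropagators, (3.42) p.397, (3.47) p.398; Balaban1984PropagatorsII, (2.51) p.232, (2.67) p.234] -/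
theorem site_coReadings_of_pins {d ℓ : ℕ} {hd : 1 ≤ d + 1} {hL : Odd (ℓ + 1) ∧ 1 < ℓ + 1} {b₀ b₁ : ℝ} {Mstar : ℕ} (x : MemberY d ℓ hd hL b₀ b₁ Mstar) {κK : Type} [Fintype κK]
    [DecidableEq κK] (bK : Module.Basis κK ℝ (Matrix (Fin N) (Fin N) ℂ)) {bI : FBondY x.toKIdx → IBondY x.toKIdx}
    (hβI : ∀ (f : FBondY x.toKIdx) (c : IBondY x.toKIdx), blkV1 x.hN x.D f = β x.hN x.D x.hk c → β x.hN x.D x.hk (bI f) = blkV1 x.hN x.D f)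
    (hlev : ∀ f : FBondY x.toKIdx, lvl x.hN x.D x.hk (bI f) = (blkV1 x.hN x.D f).1.1) (Gp : SiteOpY (Matrix (Fin N) (Fin N) ℂ) x.toKIdx) (parS : SiteParY (Matrix (Fin N) (Fin N) ℂ) x.toKIdx) {ι : Type}
    (𝔬 : Ops (geo9Y x) (bg9Y (Matrix (Fin N) (Fin N) ℂ) (specialUnitaryUnits (Fin N)) x) (XSK κK x.toKIdx) (XSK κK x.toKIdx) ι) (hblkS : 𝔬.blk = blkSK x.toKIdx (sIK x.toKIdx bI)) (hblkYS : 𝔬.blkY = blkSK x.toKIdx (sIK x.toKIdx bI))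
    (hGpS : ∀ U, 𝔬.Gp U = GcoS x.toKIdx bK (bg9Y (Matrix (Fin N) (Fin N) ℂ) (specialUnitaryUnits (Fin N)) x) (fun U => U) Gp U) (hDS : ∀ U, 𝔬.D U = DcoS x.toKIdx bK (bg9Y (Matrix (Fin N) (Fin N) ℂ) (specialUnitaryUnits (Fin N)) x) (fun U => U) U)
    (hDsS : ∀ U, 𝔬.Dstar U = DscoS x.toKIdx bK (bg9Y (Matrix (Fin N) (Fin N) ℂ) (specialUnitaryUnits (Fin N)) x) (fun U => U) U) (hLapS : ∀ U, 𝔬.Lap U = LcoS x.toKIdx bK (bg9Y (Matrix (Fin N) (Fin N) ℂ) (specialUnitaryUnits (Fin N)) x) (fun U => U) U) (U : (bg9Y (Matrix (Fin N) (Fin N) ℂ) (specialUnitaryUnits (Fin N)) x).Cfg) :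
    CoRealizesRel (kernelFamilyS x.toKIdx (bg9Y (Matrix (Fin N) (Fin N) ℂ) (specialUnitaryUnits (Fin N)) x) (fun U => U) Gp parS) 0 U (RelB x.toKIdx) 𝔬.blk 𝔬.blk (evSK x.toKIdx) (𝔬.Gp U) ∧
      CoRealizesRel (kernelFamilyS x.toKIdx (bg9Y (Matrix (Fin N) (Fin N) ℂ) (specialUnitaryUnits (Fin N)) x) (fun U => U) Gp parS) 1 U (RelB x.toKIdx) 𝔬.blkY 𝔬.blk (evSK x.toKIdx) (𝔬.D U ∘ₗ 𝔬.Gp U) ∧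
      CoRealizesRel (kernelFamilyS x.toKIdx (bg9Y (Matrix (Fin N) (Fin N) ℂ) (specialUnitaryUnits (Fin N)) x) (fun U => U) Gp parS) 2 U (RelB x.toKIdx) 𝔬.blk 𝔬.blkY (evSK x.toKIdx) (𝔬.Gp U ∘ₗ 𝔬.Dstar U) ∧
      CoRealizesRel (kernelFamilyS x.toKIdx (bg9Y (Matrix (Fin N) (Fin N) ℂ) (specialUnitaryUnits (Fin N)) x) (fun U => U) Gp parS) 3 U (RelB x.toKIdx) 𝔬.blk 𝔬.blk (evSK x.toKIdx) (𝔬.Lap U ∘ₗ 𝔬.Gp U) ∧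
      GlobReads (kernelFamilyS x.toKIdx (bg9Y (Matrix (Fin N) (Fin N) ℂ) (specialUnitaryUnits (Fin N)) x) (fun U => U) Gp parS) 0 U 𝔬.blk 𝔬.blk (evSK x.toKIdx) (𝔬.Gp U) ∧ GlobReads (kernelFamilyS x.toKIdx (bg9Y (Matrix (Fin N) (Fin N) ℂ) (specialUnitaryUnits (Fin N)) x) (fun U => U) Gp parS) 1 U 𝔬.blkY 𝔬.blk (evSK x.toKIdx) (𝔬.D U ∘ₗ 𝔬.Gp U) ∧
      GlobReads (kernelFamilyS x.toKIdx (bg9Y (Matrix (Fin N) (Fin N) ℂ) (specialUnitaryUnits (Fin N)) x) (fun U => U) Gp parS) 2 U 𝔬.blk 𝔬.blkY (evSK x.toKIdx) (𝔬.Gp U ∘ₗ 𝔬.Dstar U) ∧ GlobReads (kernelFamilyS x.toKIdx (bg9Y (Matrix (Fin N) (Fin N) ℂ) (specialUnitaryUnits (Fin N)) x) (fun U => U) Gp parS) 3 U 𝔬.blk 𝔬.blk (evSK x.toKIdx) (𝔬.Lap U ∘ₗ 𝔬.Gp U) := by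
  refine ⟨?_, ?_, ?_, ?_, ?_, ?_, ?_, ?_⟩
  · have h' := coRealizesRel_kernelFamilyS_coords_zero x.toKIdx bK (bg9Y (Matrix (Fin N) (Fin N) ℂ) (specialUnitaryUnits (Fin N)) x) (fun U => U) Gp parS U (sIK_faithful x.toKIdx hβI); rw [← hblkS, ← hGpS U] at h'; exact h'
  · have h' := coRealizesRel_kernelFamilyS_coords_one x.toKIdx bK (bg9Y (Matrix (Fin N) (Fin N) ℂ) (specialUnitaryUnits (Fin N)) x) (fun U => U) Gp parS U (sIK_faithful x.toKIdx hβI)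
    nth_rw 1 [← hblkYS] at h'; rw [← hblkS, ← hDS U, ← hGpS U] at h'; exact h'
  · have h' := coRealizesRel_kernelFamilyS_coords_two x.toKIdx bK (bg9Y (Matrix (Fin N) (Fin N) ℂ) (specialUnitaryUnits (Fin N)) x) (fun U => U) Gp parS U (sIK_faithful x.toKIdx hβI)
    nth_rw 2 [← hblkYS] at h'; rw [← hblkS, ← hGpS U, ← hDsS U] at h'; exact h'
  · have h' := coRealizesRel_kernelFamilyS_coords_three x.toKIdx bK (bg9Y (Matrix (Fin N) (Fin N) ℂ) (specialUnitaryUnits (Fin N)) x) (fun U => U) Gp parS U (sIK_faithful x.toKIdx hβI)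
    rw [← hblkS, ← hLapS U, ← hGpS U] at h'; exact h'
  · have h' := globReads_kernelFamilyS_coords_zero x.toKIdx bK (bg9Y (Matrix (Fin N) (Fin N) ℂ) (specialUnitaryUnits (Fin N)) x) (fun U => U) Gp parS U (sIK_level x.toKIdx hlev); rw [← hblkS, ← hGpS U] at h'; exact h'
  · have h' := globReads_kernelFamilyS_coords_one x.toKIdx bK (bg9Y (Matrix (Fin N) (Fin N) ℂ) (specialUnitaryUnits (Fin N)) x) (fun U => U) Gp parS U (sIK_level x.toKIdx hlev)
    nth_rw 1 [← hblkYS] at h'; rw [← hblkS, ← hDS U, ← hGpS U] at h'; exact h'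
  · have h' := globReads_kernelFamilyS_coords_two x.toKIdx bK (bg9Y (Matrix (Fin N) (Fin N) ℂ) (specialUnitaryUnits (Fin N)) x) (fun U => U) Gp parS U (sIK_level x.toKIdx hlev)
    nth_rw 2 [← hblkYS] at h'; rw [← hblkS, ← hGpS U, ← hDsS U] at h'; exact h'
  · have h' := globReads_kernelFamilyS_coords_three x.toKIdx bK (bg9Y (Matrix (Fin N) (Fin N) ℂ) (specialUnitaryUnits (Fin N)) x) (fun U => U) Gp parS U (sIK_level x.toKIdx hlev)
    rw [← hblkS, ← hLapS U, ← hGpS U] at h'; exact h'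

/-- **THE STAGE-11 CERTIFICATE AT `opsYOfRecordV4E N θ M⋆ 𝔯 𝔢 𝔴 𝔈` WITH THE COORDINATE PINS** (module docstring): the 28-row composition at def-Y's v4
instance of record — row 24 through the (3.185) slot (n06-m `…SectERepOn`, one schema `hE`), row 11 with no binder (n06-h `hGp_opsYOfLetters_holds`), row 13 from
one `F : SectBFrame₃` (n06-c), rows 22–23 on the cancellation-layer face at the v4
letters, rows 18–19 on n06-k's Nbr face (`L2ReadsNbr ∕ H1ReadsNbr ∕ InputReadsNbr`, `mN Cev hnbr`), row 26 DISPLAYED WHOLE (`s3132`, LOCATED FALSE at the flat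
reading — the certificate is conditional on it), the G-side ∕ Thm-3.12–3.13 walk letters on `XBK κK x.toKIdx` pinned (`hblkA … hLcoA`, `hblk12 … hDsco12`)
to the coordinate models of the GENUINE letters over a faithful `bI` (the 26 bond-sector co-readings of rows 19–21 are theorems), row 25 from `h31S h32B`.  NOT a
discharge of N06. [cite: Balaban1985BackgroundPropagators, Thms 3.1–3.15 pp.397–432, (3.39)–(3.42) p.397, (3.47) p.398, (3.49) p.399, (3.185) p.431;
Balaban1984PropagatorsII, (2.45) p.231, (2.51)–(2.52) p.232, Lemma 2.1 (2.60)–(2.61) pp.233–234] -/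
theorem b9_main_of_up_view₁₁B10YZW_opsYOfRecordV4E_coordsS
    (θ : Stage11Params F N) (hθ : θ.Admissible) (Mstar : ℕ) (𝔯 : ResY N θ.toStage3Params Mstar) (𝔢 : SectEY N θ.toStage3Params Mstar) (𝔴 : RWEY N θ.toStage3Params Mstar) (𝔈 : ExpsY N θ.toStage3Params Mstar) (ζ : ResidZ F N) (lamW : ResidW F N) (w : WorldP)
    (hup : ∀ P, w.up P = upOfRecord₅C F N (θ.view₁₁B10YZW F N Mstar (opsYOfRecordV4E N θ.toStage3Params Mstar 𝔯 𝔢 𝔴 𝔈) ζ lamW) P) [∀ x : MemberY θ.d₆ θ.ℓ₆ θ.hd' θ.hL' θ.b₀ θ.b₁ Mstar, Fintype (geo9Y x).Site] [∀ x : MemberY θ.d₆ θ.ℓ₆ θ.hd' θ.hL' θ.b₀ θ.b₁ Mstar, DecidableEq (geo9Y x).Site]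
    -- the carrier-block equivalence `RelB` of the record is decidable (any instance; `Classical.decRel` or the blocks' `DecidableEq`)
    [∀ x : MemberY θ.d₆ θ.ℓ₆ θ.hd' θ.hL' θ.b₀ θ.b₁ Mstar, DecidableRel (RelB x.toKIdx)]
    -- the κ-fold coordinate data of the instance (n06-d `B9CoReadingCoords`): a real basis of M_N(ℂ) and a block map on the fine bonds, carrier- and level-faithful
    -- (exists at every member: n06-l `exists_carrierFaithful` ∕ `B9IndexBondAtLevel`); every bond-sector co-reading of rows 19–21 is DISCHARGED on these gadgets
    {κK : Type} [Fintype κK] [DecidableEq κK] (bK : Module.Basis κK ℝ (Matrix (Fin N) (Fin N) ℂ)) (bI : ∀ x : MemberY θ.d₆ θ.ℓ₆ θ.hd' θ.hL' θ.b₀ θ.b₁ Mstar, FBondY x.toKIdx → IBondY x.toKIdx)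
    (hβI : ∀ (x : MemberY θ.d₆ θ.ℓ₆ θ.hd' θ.hL' θ.b₀ θ.b₁ Mstar) (f : FBondY x.toKIdx) (c : IBondY x.toKIdx), blkV1 x.hN x.D f = β x.hN x.D x.hk c → β x.hN x.D x.hk (bI x f) = blkV1 x.hN x.D f)
    (hlev : ∀ (x : MemberY θ.d₆ θ.ℓ₆ θ.hd' θ.hL' θ.b₀ θ.b₁ Mstar) (f : FBondY x.toKIdx), lvl x.hN x.D x.hk (bI x f) = (blkV1 x.hN x.D f).1.1)
    -- row 11 has NO binder: n06-h g5 `B9Ineq344LocalPairHolds.hGp_opsYOfLetters_holds` (the located residual schema of (3.44)∕(3.45) at U = 1 is a theorem)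
    -- row 13 on n06-c g4's frame OF RECORD `SectBFrame₃` (`N06SectBOfFrameV3.hB_obligation_of_sectBFrame₃`, p506914∕p508689): [B9] Sect. B (3.50)–(3.69) — Lemma-2.1 fields,
    -- the L² readings∕writings of its own `KernelFamily.l2`, and ELEVEN displayed positive-input block-steps (G′ members 3, 5; the six G members; (3.43)–(3.45) of G)
    [∀ x : MemberY θ.d₆ θ.ℓ₆ θ.hd' θ.hL' θ.b₀ θ.b₁ Mstar, Nonempty (geo9Y x).Site] {ιB κB : Type} [Fintype ιB] [DecidableEq ιB] [Fintype κB] [LinearOrder κB] (bB : Module.Basis ιB ℝ (Matrix (Fin N) (Fin N) ℂ)) (SB : MemberY θ.d₆ θ.ℓ₆ θ.hd' θ.hL' θ.b₀ θ.b₁ Mstar → Type) [∀ x, Fintype (SB x)]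
    [∀ x, DecidableEq (SB x)]
    (F : SectBFrame₃ c35Y geo9Y (bg9Y (Matrix (Fin N) (Fin N) ℂ) (specialUnitaryUnits (Fin N))) (fun x => ((opsYOfRecordV4E N θ.toStage3Params Mstar 𝔯 𝔢 𝔴 𝔈) x).Gp) bB κB SB (fun x => ((opsYOfRecordV4E N θ.toStage3Params Mstar 𝔯 𝔢 𝔴 𝔈) x).GA) (fun x => ((opsYOfRecordV4E N θ.toStage3Params Mstar 𝔯 𝔢 𝔴 𝔈) x).Cinv) (fun x => ((opsYOfRecordV4E N θ.toStage3Params Mstar 𝔯 𝔢 𝔴 𝔈) x).IsAnalyticExt))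
    (hdB : F.dB = θ.d₆ + 1)
    -- rows 15–16: Theorem 3.9's carrier letters on the block carrier `X39`, read by `rd39`; printed-shape schemas; the three pins (n06-j g5)
    {ι39 κ39 : MemberY θ.d₆ θ.ℓ₆ θ.hd' θ.hL' θ.b₀ θ.b₁ Mstar → Type} [∀ x, Fintype (ι39 x)] (𝔬39 : ∀ x : MemberY θ.d₆ θ.ℓ₆ θ.hd' θ.hL' θ.b₀ θ.b₁ Mstar, Ops39Blk (geo9Y x) (bg9Y (Matrix (Fin N) (Fin N) ℂ) (specialUnitaryUnits (Fin N)) x) (X39 (Matrix (Fin N) (Fin N) ℂ) x.toKIdx) (ι39 x) (κ39 x))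
    (rd39 : ∀ x : MemberY θ.d₆ θ.ℓ₆ θ.hd' θ.hL' θ.b₀ θ.b₁ Mstar, WalkReading39 (bg9Y (Matrix (Fin N) (Fin N) ℂ) (specialUnitaryUnits (Fin N)) x) (ι39 x) (κ39 x)) (α39 α' r39 δ39 θ39 B39 N39 a39 M39 : ℝ) (h39α : 0 < α39) (h39α1 : α39 < 1) (hα'0 : 0 < α') (hα'1 : α' < 1) (hr39 : 0 < r39)
    (hrδ39 : r39 ≤ δ39) (hθ39 : 0 ≤ θ39) (hB39 : 0 < B39) (hN39 : 0 ≤ N39) (ha39 : 0 < a39) (hM39 : 0 < M39) (hst39 : ∀ x, StaticOK39Blk (𝔬39 x) N39) (hloc39 : ∀ x, Locality39Blk (𝔬39 x) (rd39 x))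
    (h39 : ∀ x : MemberY θ.d₆ θ.ℓ₆ θ.hd' θ.hL' θ.b₀ θ.b₁ Mstar, M39 ≤ (geo9Y x).M → ∀ α₀ : ℝ, 0 < α₀ → c35Y * (geo9Y x).M * α₀ ≤ a39 → ∀ U : (bg9Y (Matrix (Fin N) (Fin N) ℂ) (specialUnitaryUnits (Fin N)) x).Cfg, (bg9Y (Matrix (Fin N) (Fin N) ℂ) (specialUnitaryUnits (Fin N)) x).Reg335 c35Y α₀ U →
      Local348Blk (𝔬39 x) B39 δ39 U ∧ Identities395Blk (𝔬39 x) U ∧ Small285Blk (𝔬39 x) θ39 r39 U ∧ Factors389Blk (𝔬39 x) θ39 δ39 U)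
    (hblk39 : ∀ x, (𝔬39 x).blk = blk39 (Matrix (Fin N) (Fin N) ℂ) x.toKIdx) (hL39 : ∀ x, (𝔬39 x).L = L39 x.toKIdx (lettersYOfRecordV4 N θ.toStage3Params Mstar 𝔯 x).parS (lettersYOfRecordV4 N θ.toStage3Params Mstar 𝔯 x).Gp)
    (hEK39 : ∀ x : MemberY θ.d₆ θ.ℓ₆ θ.hd' θ.hL' θ.b₀ θ.b₁ Mstar, ((opsYOfRecordV4E N θ.toStage3Params Mstar 𝔯 𝔢 𝔴 𝔈) x).EK39 = EK39OfOpsBlkVia (𝔬39 x) (rd39 x) (θ.d₆ + 1) (2 * (N39 * B39) * rowConst261 (geo9Y (d := θ.d₆) (ℓ := θ.ℓ₆) (hd := θ.hd') (hL := θ.hL') (b₀ := θ.b₀) (b₁ := θ.b₁) (Mstar :=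
      Mstar)) (α' * r39)) ((1 - α') * r39) (repSite39 x.toKIdx))
    -- row 17 on n06-j g6's face `t311_of_pins_opsYOfLetters` (UN-PADDED): Theorem 3.11's proof letters `𝔔` in orthonormal trace coordinates, the schema `Inputs311Y`
    -- about def-Y's GENUINE Δ′_a(U), G′(U), (Q′G′²Q′*)⁻¹(U), Δ_a(U), G(U) of the v3 record, and the pin `hPD` of the free predicate letter `PosDef`
    (𝔔 : ∀ x : MemberY θ.d₆ θ.ℓ₆ θ.hd' θ.hL' θ.b₀ θ.b₁ Mstar, ProofLetters311 N x.toKIdx) (θ311 a311 M311 : ℝ) (ha311 : 0 < a311) (hM311 : 0 < M311)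
    (h311Y : ∀ x : MemberY θ.d₆ θ.ℓ₆ θ.hd' θ.hL' θ.b₀ θ.b₁ Mstar, M311 ≤ (geo9Y x).M → ∀ α₀ : ℝ, 0 < α₀ → (geo9Y x).M * α₀ ≤ a311 → ∀ U : (bg9Y (Matrix (Fin N) (Fin N) ℂ) (specialUnitaryUnits (Fin N)) x).Cfg, (bg9Y (Matrix (Fin N) (Fin N) ℂ) (specialUnitaryUnits (Fin N)) x).Reg335 c35Y α₀ U →
      Inputs311Y x (lettersYOfRecordV4 N θ.toStage3Params Mstar 𝔯 x) (𝔔 x) θ311 (geo9Y x).M U)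
    (hPD : ∀ x : MemberY θ.d₆ θ.ℓ₆ θ.hd' θ.hL' θ.b₀ θ.b₁ Mstar, ((opsYOfRecordV4E N θ.toStage3Params Mstar 𝔯 𝔢 𝔴 𝔈) x).PosDef = PosDefOfOps (ops311Y x (lettersYOfRecordV4 N θ.toStage3Params Mstar 𝔯 x) (𝔔 x)))
    -- rows 18–19 on n06-k g8's Nbr face `rows131819_definite_geo9Y_nbr` (Thm 3.7 ∕ Cor. 3.8 ∕ Thm 3.10 + «the RW sums yield (3.42)–(3.47)» at the definite E-letters
    -- `E37YNbr`∕`E310YNbr`): walk letters of G′(U) (free carriers `X Y`, evaluations `ev evY`) and of G(U) (PINNED on `XBK κK`, `evBK`), static∕locality schemas, Cor. 3.6's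
    -- packages (posited, printed shape), the (3.46)∕(3.43)∕input co-readings in the Nbr species `L2ReadsNbr … 2 Cev` ∕ `H1ReadsNbr … 2` ∕ `InputReadsNbr … 2` (radius-2
    -- anchoring, constant `Cev` — the Rel species `L2ReadsRel` is REFUTED at the pinned `evBK`, n06-k `not_l2ReadsRel_evBK` p503700), transposes, support counts, the
    -- two E-pins; `Rel := RelB`, `m := 2(d+1)`, `hRlen hRd₁ hRd₂ hmult` DISCHARGED at the record; `mN`, `Cev`, `hnbr` displayed
    {ι PX PY ιA AA PXA PYA : MemberY θ.d₆ θ.ℓ₆ θ.hd' θ.hL' θ.b₀ θ.b₁ Mstar → Type} [∀ x, Fintype (ι x)] [∀ x, Fintype (PX x)] [∀ x, DecidableEq (PX x)] [∀ x, Fintype (PY x)] [∀ x, DecidableEq (PY x)]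
    [∀ x, Fintype (ιA x)] [∀ x, Fintype (AA x)] [∀ x, Fintype (PXA x)] [∀ x, DecidableEq (PXA x)] [∀ x, Fintype (PYA x)] [∀ x, DecidableEq (PYA x)] (p q : PinPrims) (hp : p.OK) (hq : q.OK) (H : MemberY θ.d₆ θ.ℓ₆ θ.hd' θ.hL' θ.b₀ θ.b₁ Mstar → Prop)
    (mN : ℕ) (Cev : ℝ) (hCev : 0 ≤ Cev) (hnbr : ∀ (x : MemberY θ.d₆ θ.ℓ₆ θ.hd' θ.hL' θ.b₀ θ.b₁ Mstar) (y : (geo9Y x).Site), (nbr (geo9Y x) 2 y).card ≤ mN)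
    (𝔬 : ∀ x : MemberY θ.d₆ θ.ℓ₆ θ.hd' θ.hL' θ.b₀ θ.b₁ Mstar, Ops (geo9Y x) (bg9Y (Matrix (Fin N) (Fin N) ℂ) (specialUnitaryUnits (Fin N)) x) (XSK κK x.toKIdx) (XSK κK x.toKIdx) (ι x))
    (rd : ∀ x : MemberY θ.d₆ θ.ℓ₆ θ.hd' θ.hL' θ.b₀ θ.b₁ Mstar, WalkReading (geo9Y x) (bg9Y (Matrix (Fin N) (Fin N) ℂ) (specialUnitaryUnits (Fin N)) x) (XSK κK x.toKIdx) (ι x))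
    (𝔭 : ∀ x : MemberY θ.d₆ θ.ℓ₆ θ.hd' θ.hL' θ.b₀ θ.b₁ Mstar, HolderProbes (geo9Y x) (bg9Y (Matrix (Fin N) (Fin N) ℂ) (specialUnitaryUnits (Fin N)) x) (XSK κK x.toKIdx) (XSK κK x.toKIdx) (PX x) (PY x)) (bH : ∀ x : MemberY θ.d₆ θ.ℓ₆ θ.hd' θ.hL' θ.b₀ θ.b₁ Mstar, ℝ → BlockNorm (toB6 (geo9Y x) 1 (H x)) (XSK κK x.toKIdx → ℝ))
    (κ : MemberY θ.d₆ θ.ℓ₆ θ.hd' θ.hL' θ.b₀ θ.b₁ Mstar → Sizes)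
    (SH SL SI S2 : ∀ x : MemberY θ.d₆ θ.ℓ₆ θ.hd' θ.hL' θ.b₀ θ.b₁ Mstar, ι x → Finset (geo9Y x).Site) (hst : ∀ x, StaticOK (𝔬 x) p.ρ p.Nc p.N' p.Cℓ (κ x)) (hκ : ∀ x, (κ x).Bounded p.Kc p.θ₀ p.Cℓ (geo9Y x).M) (hrd : ∀ x, (rd x).OK (𝔬 x).blk) (hloc : ∀ x, Locality (𝔬 x) (rd x))
    (h36 : ∀ x, p.M₁ ≤ (geo9Y x).M → ∀ α₀ : ℝ, 0 < α₀ → c35Y * (geo9Y x).M * α₀ ≤ p.a₁ → ∀ U : (bg9Y (Matrix (Fin N) (Fin N) ℂ) (specialUnitaryUnits (Fin N)) x).Cfg, (bg9Y (Matrix (Fin N) (Fin N) ℂ) (specialUnitaryUnits (Fin N)) x).Reg335 c35Y α₀ U → Local342 (𝔬 x) 1 (H x) p.B₀ p.δ₀ U ∧ Identities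
      (𝔬 x) 1 (H x) U)
    (h36H : ∀ x, p.M₁ ≤ (geo9Y x).M → ∀ α₀ : ℝ, 0 < α₀ → c35Y * (geo9Y x).M * α₀ ≤ p.a₁ → ∀ U : (bg9Y (Matrix (Fin N) (Fin N) ℂ) (specialUnitaryUnits (Fin N)) x).Cfg, (bg9Y (Matrix (Fin N) (Fin N) ℂ) (specialUnitaryUnits (Fin N)) x).Reg335 c35Y α₀ U → HolderLegs37 (𝔬 x) (𝔭 x) 1 (H x) (SH x) p.Bl
      p.δ₀ U ∧ HolderV37 (𝔬 x) (𝔭 x) 1 (H x) p.Bt p.δ₀ U ∧ LapLegs37 (𝔬 x) 1 (H x) (SL x) p.BL p.δ₀ U ∧ InputLegs37 (𝔬 x) (𝔭 x) 1 (H x) (bH x) (SI x) p.BI p.BI2 p.δ₀ U ∧ FactorsInput37 (𝔬 x) 1 (H x) (bH x) p.θI p.δ₀ U ∧ L2TwoLegs37 (𝔬 x) 1 (H x) (S2 x) p.B2 p.δ₀ U ∧ FactorsL2_37 (𝔬 x) 1 (H x) p.θ2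
      p.δ₀ U)
    (hl0 : ∀ x U, L2ReadsNbr (R := 1) (H := H x) ((opsYOfRecordV4E N θ.toStage3Params Mstar 𝔯 𝔢 𝔴 𝔈) x).Gp 0 U (RelB x.toKIdx) 2 Cev (𝔬 x).blk (𝔬 x).blk (evSK x.toKIdx) ((𝔬 x).Gp U))
    (hl1 : ∀ x U, L2ReadsNbr (R := 1) (H := H x) ((opsYOfRecordV4E N θ.toStage3Params Mstar 𝔯 𝔢 𝔴 𝔈) x).Gp 1 U (RelB x.toKIdx) 2 Cev (𝔬 x).blkY (𝔬 x).blk (evSK x.toKIdx) ((𝔬 x).D U ∘ₗ (𝔬 x).Gp U))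
    (hl2 : ∀ x U, L2ReadsNbr (R := 1) (H := H x) ((opsYOfRecordV4E N θ.toStage3Params Mstar 𝔯 𝔢 𝔴 𝔈) x).Gp 2 U (RelB x.toKIdx) 2 Cev (𝔬 x).blk (𝔬 x).blkY (evSK x.toKIdx) ((𝔬 x).Gp U ∘ₗ (𝔬 x).Dstar U))
    (hl3 : ∀ x U, L2ReadsNbr (R := 1) (H := H x) ((opsYOfRecordV4E N θ.toStage3Params Mstar 𝔯 𝔢 𝔴 𝔈) x).Gp 3 U (RelB x.toKIdx) 2 Cev (𝔬 x).blk (𝔬 x).blk (evSK x.toKIdx) ((𝔬 x).Lap U ∘ₗ (𝔬 x).Gp U))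
    (hl4 : ∀ x U, L2ReadsNbr (R := 1) (H := H x) ((opsYOfRecordV4E N θ.toStage3Params Mstar 𝔯 𝔢 𝔴 𝔈) x).Gp 4 U (RelB x.toKIdx) 2 Cev (𝔬 x).blkY (𝔬 x).blkY (evSK x.toKIdx) ((𝔬 x).D U ∘ₗ ((𝔬 x).Gp U ∘ₗ (𝔬 x).Dstar U)))
    (hl5 : ∀ x U, L2ReadsNbr (R := 1) (H := H x) ((opsYOfRecordV4E N θ.toStage3Params Mstar 𝔯 𝔢 𝔴 𝔈) x).Gp 5 U (RelB x.toKIdx) 2 Cev (𝔬 x).blk (𝔬 x).blk (evSK x.toKIdx) ((𝔬 x).Gp U ∘ₗ (𝔬 x).Lap U))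
    (hH1 : ∀ x U, H1ReadsNbr ((opsYOfRecordV4E N θ.toStage3Params Mstar 𝔯 𝔢 𝔴 𝔈) x).Gp U (𝔭 x) (RelB x.toKIdx) 2 (𝔬 x).blk (𝔬 x).blkY (evSK x.toKIdx) (evSK x.toKIdx) ((𝔬 x).D U ∘ₗ (𝔬 x).Gp U) ((𝔬 x).Gp U ∘ₗ (𝔬 x).Dstar U))
    (hIR : ∀ x U, InputReadsNbr ((opsYOfRecordV4E N θ.toStage3Params Mstar 𝔯 𝔢 𝔴 𝔈) x).Gp U (𝔭 x) (bH x) 2 (𝔬 x).blkY (evSK x.toKIdx) ((𝔬 x).D U ∘ₗ ((𝔬 x).Gp U ∘ₗ (𝔬 x).Dstar U))) (hsym : ∀ x U, IsTransposePair ((𝔬 x).Gp U) ((𝔬 x).Gp U))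
    (htr : ∀ x U, IsTransposePair ((𝔬 x).D U ∘ₗ (𝔬 x).Gp U) ((𝔬 x).Gp U ∘ₗ (𝔬 x).Dstar U)) (hadjL : ∀ x U, IsTransposePair ((𝔬 x).Lap U ∘ₗ (𝔬 x).Gp U) ((𝔬 x).Gp U ∘ₗ (𝔬 x).Lap U)) (hcntH : ∀ x (a : (geo9Y x).Site), (∑ c, if a ∈ SH x c then (1 : ℝ) else 0) ≤ p.NH)
    (hcntL : ∀ x (a : (geo9Y x).Site), (∑ c, if a ∈ SL x c then (1 : ℝ) else 0) ≤ p.NL) (hcntI : ∀ x (a : (geo9Y x).Site), (∑ c, if a ∈ SI x c then (1 : ℝ) else 0) ≤ p.NI) (hcnt2 : ∀ x (a : (geo9Y x).Site), (∑ c, if a ∈ S2 x c then (1 : ℝ) else 0) ≤ p.N2)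
    -- the G side (Theorem 3.10)
    (𝔬A : ∀ x : MemberY θ.d₆ θ.ℓ₆ θ.hd' θ.hL' θ.b₀ θ.b₁ Mstar, Ops310 (geo9Y x) (bg9Y (Matrix (Fin N) (Fin N) ℂ) (specialUnitaryUnits (Fin N)) x) (XBK κK x.toKIdx) (XBK κK x.toKIdx) (ιA x) (AA x))
    (rdA : ∀ x : MemberY θ.d₆ θ.ℓ₆ θ.hd' θ.hL' θ.b₀ θ.b₁ Mstar, WalkReading310 (geo9Y x) (bg9Y (Matrix (Fin N) (Fin N) ℂ) (specialUnitaryUnits (Fin N)) x) (XBK κK x.toKIdx) (ιA x) (AA x))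
    (𝔭A : ∀ x : MemberY θ.d₆ θ.ℓ₆ θ.hd' θ.hL' θ.b₀ θ.b₁ Mstar, HolderProbes (geo9Y x) (bg9Y (Matrix (Fin N) (Fin N) ℂ) (specialUnitaryUnits (Fin N)) x) (XBK κK x.toKIdx) (XBK κK x.toKIdx) (PXA x) (PYA x))
    (bHA : ∀ x : MemberY θ.d₆ θ.ℓ₆ θ.hd' θ.hL' θ.b₀ θ.b₁ Mstar, ℝ → BlockNorm (toB6 (geo9Y x) 1 (H x)) (XBK κK x.toKIdx → ℝ)) (κA : MemberY θ.d₆ θ.ℓ₆ θ.hd' θ.hL' θ.b₀ θ.b₁ Mstar → Sizes310) (SHA SLA SIA S2A : ∀ x : MemberY θ.d₆ θ.ℓ₆ θ.hd' θ.hL' θ.b₀ θ.b₁ Mstar, ιA x → Finset (geo9Y x).Site)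
    (hstA : ∀ x, StaticOK310 (𝔬A x) q.ρ q.Nc q.N' q.NF q.Cℓ (κA x)) (hκA : ∀ x, (κA x).Bounded q.Kc) (hrdA : ∀ x, (rdA x).OK (𝔬A x).blk) (hlocA : ∀ x, Locality310 (𝔬A x) (rdA x))
    (h36A : ∀ x, q.M₁ ≤ (geo9Y x).M → ∀ α₀ : ℝ, 0 < α₀ → c35Y * (geo9Y x).M * α₀ ≤ q.a₁ → ∀ U : (bg9Y (Matrix (Fin N) (Fin N) ℂ) (specialUnitaryUnits (Fin N)) x).Cfg, (bg9Y (Matrix (Fin N) (Fin N) ℂ) (specialUnitaryUnits (Fin N)) x).Reg335 c35Y α₀ U → Local342G (𝔬A x) 1 (H x) q.B₀ q.δ₀ U ∧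
      B9Thm310Whole.Factors389 (𝔬A x) 1 (H x) q.θ₀ q.δ₀ U ∧ Identities310 (𝔬A x) 1 (H x) U)
    (h36HA : ∀ x, q.M₁ ≤ (geo9Y x).M → ∀ α₀ : ℝ, 0 < α₀ → c35Y * (geo9Y x).M * α₀ ≤ q.a₁ → ∀ U : (bg9Y (Matrix (Fin N) (Fin N) ℂ) (specialUnitaryUnits (Fin N)) x).Cfg, (bg9Y (Matrix (Fin N) (Fin N) ℂ) (specialUnitaryUnits (Fin N)) x).Reg335 c35Y α₀ U → HolderLegs310 (𝔬A x) (𝔭A x) 1 (H x) (SHA x)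
      q.Bl q.δ₀ U ∧ FactorsHolder310 (𝔬A x) (𝔭A x) 1 (H x) q.Bt q.δ₀ U ∧ LapLegs310 (𝔬A x) 1 (H x) (SLA x) q.BL q.δ₀ U ∧ InputLegs310 (𝔬A x) (𝔭A x) 1 (H x) (bHA x) (SIA x) q.BI q.BI2 q.δ₀ U ∧ FactorsInput310 (𝔬A x) 1 (H x) (bHA x) q.θI q.δ₀ U ∧ L2TwoLegs310 (𝔬A x) 1 (H x) (S2A x) q.B2 q.δ₀ U ∧
      FactorsL2_310 (𝔬A x) 1 (H x) q.θ2 q.δ₀ U)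
    (hlA0 : ∀ x U, L2ReadsNbr (R := 1) (H := H x) ((opsYOfRecordV4E N θ.toStage3Params Mstar 𝔯 𝔢 𝔴 𝔈) x).GA 0 U (RelB x.toKIdx) 2 Cev (𝔬A x).blk (𝔬A x).blk (evBK x.toKIdx) ((𝔬A x).G U))
    (hlA1 : ∀ x U, L2ReadsNbr (R := 1) (H := H x) ((opsYOfRecordV4E N θ.toStage3Params Mstar 𝔯 𝔢 𝔴 𝔈) x).GA 1 U (RelB x.toKIdx) 2 Cev (𝔬A x).blkY (𝔬A x).blk (evBK x.toKIdx) ((𝔬A x).D U ∘ₗ (𝔬A x).G U))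
    (hlA2 : ∀ x U, L2ReadsNbr (R := 1) (H := H x) ((opsYOfRecordV4E N θ.toStage3Params Mstar 𝔯 𝔢 𝔴 𝔈) x).GA 2 U (RelB x.toKIdx) 2 Cev (𝔬A x).blk (𝔬A x).blkY (evBK x.toKIdx) ((𝔬A x).G U ∘ₗ (𝔬A x).Dstar U))
    (hlA3 : ∀ x U, L2ReadsNbr (R := 1) (H := H x) ((opsYOfRecordV4E N θ.toStage3Params Mstar 𝔯 𝔢 𝔴 𝔈) x).GA 3 U (RelB x.toKIdx) 2 Cev (𝔬A x).blk (𝔬A x).blk (evBK x.toKIdx) ((𝔬A x).Lap U ∘ₗ (𝔬A x).G U))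
    (hlA4 : ∀ x U, L2ReadsNbr (R := 1) (H := H x) ((opsYOfRecordV4E N θ.toStage3Params Mstar 𝔯 𝔢 𝔴 𝔈) x).GA 4 U (RelB x.toKIdx) 2 Cev (𝔬A x).blkY (𝔬A x).blkY (evBK x.toKIdx) ((𝔬A x).D U ∘ₗ ((𝔬A x).G U ∘ₗ (𝔬A x).Dstar U)))
    (hlA5 : ∀ x U, L2ReadsNbr (R := 1) (H := H x) ((opsYOfRecordV4E N θ.toStage3Params Mstar 𝔯 𝔢 𝔴 𝔈) x).GA 5 U (RelB x.toKIdx) 2 Cev (𝔬A x).blk (𝔬A x).blk (evBK x.toKIdx) ((𝔬A x).G U ∘ₗ (𝔬A x).Lap U))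
    (hH1A : ∀ x U, H1ReadsNbr ((opsYOfRecordV4E N θ.toStage3Params Mstar 𝔯 𝔢 𝔴 𝔈) x).GA U (𝔭A x) (RelB x.toKIdx) 2 (𝔬A x).blk (𝔬A x).blkY (evBK x.toKIdx) (evBK x.toKIdx) ((𝔬A x).D U ∘ₗ (𝔬A x).G U) ((𝔬A x).G U ∘ₗ (𝔬A x).Dstar U))
    (hIRA : ∀ x U, InputReadsNbr ((opsYOfRecordV4E N θ.toStage3Params Mstar 𝔯 𝔢 𝔴 𝔈) x).GA U (𝔭A x) (bHA x) 2 (𝔬A x).blkY (evBK x.toKIdx) ((𝔬A x).D U ∘ₗ ((𝔬A x).G U ∘ₗ (𝔬A x).Dstar U))) (hsymA : ∀ x U, IsTransposePair ((𝔬A x).G U) ((𝔬A x).G U))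
    (htrA : ∀ x U, IsTransposePair ((𝔬A x).D U ∘ₗ (𝔬A x).G U) ((𝔬A x).G U ∘ₗ (𝔬A x).Dstar U)) (hadjLA : ∀ x U, IsTransposePair ((𝔬A x).Lap U ∘ₗ (𝔬A x).G U) ((𝔬A x).G U ∘ₗ (𝔬A x).Lap U)) (hcntHA : ∀ x (a : (geo9Y x).Site), (∑ c, if a ∈ SHA x c then (1 : ℝ) else 0) ≤ q.NH)
    (hcntLA : ∀ x (a : (geo9Y x).Site), (∑ c, if a ∈ SLA x c then (1 : ℝ) else 0) ≤ q.NL) (hcntIA : ∀ x (a : (geo9Y x).Site), (∑ c, if a ∈ SIA x c then (1 : ℝ) else 0) ≤ q.NI) (hcnt2A : ∀ x (a : (geo9Y x).Site), (∑ c, if a ∈ S2A x c then (1 : ℝ) else 0) ≤ q.N2)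
    (hE37 : ∀ x : MemberY θ.d₆ θ.ℓ₆ θ.hd' θ.hL' θ.b₀ θ.b₁ Mstar, ((opsYOfRecordV4E N θ.toStage3Params Mstar 𝔯 𝔢 𝔴 𝔈) x).E37 = E37YNbr (bg := bg9Y (Matrix (Fin N) (Fin N) ℂ) (specialUnitaryUnits (Fin N))) (2 * (θ.d₆ + 1)) mN Cev p q (𝔬 x) (rd x) (H x) ((opsYOfRecordV4E N θ.toStage3Params Mstar 𝔯 𝔢 𝔴 𝔈) x).Gp)
    (hE310 : ∀ x : MemberY θ.d₆ θ.ℓ₆ θ.hd' θ.hL' θ.b₀ θ.b₁ Mstar, ((opsYOfRecordV4E N θ.toStage3Params Mstar 𝔯 𝔢 𝔴 𝔈) x).E310 = E310YNbr (bg := bg9Y (Matrix (Fin N) (Fin N) ℂ) (specialUnitaryUnits (Fin N))) (2 * (θ.d₆ + 1)) mN Cev p q (𝔬A x) (rdA x) (H x) ((opsYOfRecordV4E N θ.toStage3Params Mstar 𝔯 𝔢 𝔴 𝔈)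
      x).GA)
    -- PINS of the G-side walk letters to the coordinate model of the GENUINE `G(U)` (block maps, models of G, ∇_U, ∇*_U, Δ_U) — the four `CoRealizesRel` and four `GlobReads` co-readings are theorems
    (hblkA : ∀ x : MemberY θ.d₆ θ.ℓ₆ θ.hd' θ.hL' θ.b₀ θ.b₁ Mstar, (𝔬A x).blk = blkBK x.toKIdx (bI x)) (hblkYA : ∀ x : MemberY θ.d₆ θ.ℓ₆ θ.hd' θ.hL' θ.b₀ θ.b₁ Mstar, (𝔬A x).blkY = blkBK x.toKIdx (bI x))
    (hGcoA : ∀ (x : MemberY θ.d₆ θ.ℓ₆ θ.hd' θ.hL' θ.b₀ θ.b₁ Mstar) (U : (bg9Y (Matrix (Fin N) (Fin N) ℂ) (specialUnitaryUnits (Fin N)) x).Cfg), (𝔬A x).G U = GcoK x.toKIdx bK (bg9Y (Matrix (Fin N) (Fin N) ℂ) (specialUnitaryUnits (Fin N)) x) (fun U => U) (lettersYOfRecordV4 N θ.toStage3Params Mstar 𝔯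
      x).GA U)
    (hDcoA : ∀ (x : MemberY θ.d₆ θ.ℓ₆ θ.hd' θ.hL' θ.b₀ θ.b₁ Mstar) (U : (bg9Y (Matrix (Fin N) (Fin N) ℂ) (specialUnitaryUnits (Fin N)) x).Cfg), (𝔬A x).D U = DcoK x.toKIdx bK (bg9Y (Matrix (Fin N) (Fin N) ℂ) (specialUnitaryUnits (Fin N)) x) (fun U => U) U)
    (hDscoA : ∀ (x : MemberY θ.d₆ θ.ℓ₆ θ.hd' θ.hL' θ.b₀ θ.b₁ Mstar) (U : (bg9Y (Matrix (Fin N) (Fin N) ℂ) (specialUnitaryUnits (Fin N)) x).Cfg), (𝔬A x).Dstar U = DscoK x.toKIdx bK (bg9Y (Matrix (Fin N) (Fin N) ℂ) (specialUnitaryUnits (Fin N)) x) (fun U => U) U)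
    (hLcoA : ∀ (x : MemberY θ.d₆ θ.ℓ₆ θ.hd' θ.hL' θ.b₀ θ.b₁ Mstar) (U : (bg9Y (Matrix (Fin N) (Fin N) ℂ) (specialUnitaryUnits (Fin N)) x).Cfg), (𝔬A x).Lap U = LcoK x.toKIdx bK (bg9Y (Matrix (Fin N) (Fin N) ℂ) (specialUnitaryUnits (Fin N)) x) (fun U => U) U)
    -- THE SITE PINS (row 18's G′ side): block maps through `sIK (bI x)`, models = `B9CoReadingCoordsS` coordinate models of def-Y's GENUINE site-sector letter `(𝔏 x).Gp`
    (hblkS : ∀ x : MemberY θ.d₆ θ.ℓ₆ θ.hd' θ.hL' θ.b₀ θ.b₁ Mstar, (𝔬 x).blk = blkSK x.toKIdx (sIK x.toKIdx (bI x))) (hblkYS : ∀ x : MemberY θ.d₆ θ.ℓ₆ θ.hd' θ.hL' θ.b₀ θ.b₁ Mstar, (𝔬 x).blkY = blkSK x.toKIdx (sIK x.toKIdx (bI x)))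
    (hGpS : ∀ (x : MemberY θ.d₆ θ.ℓ₆ θ.hd' θ.hL' θ.b₀ θ.b₁ Mstar) U, (𝔬 x).Gp U = GcoS x.toKIdx bK (bg9Y (Matrix (Fin N) (Fin N) ℂ) (specialUnitaryUnits (Fin N)) x) (fun U => U) (lettersYOfRecordV4 N θ.toStage3Params Mstar 𝔯 x).Gp U) (hDS : ∀ (x : MemberY θ.d₆ θ.ℓ₆ θ.hd' θ.hL' θ.b₀ θ.b₁ Mstar) U, (𝔬 x).D U = DcoS x.toKIdx bK (bg9Y (Matrix (Fin N) (Fin N) ℂ) (specialUnitaryUnits (Fin N)) x) (fun U => U) U)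
    (hDsS : ∀ (x : MemberY θ.d₆ θ.ℓ₆ θ.hd' θ.hL' θ.b₀ θ.b₁ Mstar) U, (𝔬 x).Dstar U = DscoS x.toKIdx bK (bg9Y (Matrix (Fin N) (Fin N) ℂ) (specialUnitaryUnits (Fin N)) x) (fun U => U) U) (hLapS : ∀ (x : MemberY θ.d₆ θ.ℓ₆ θ.hd' θ.hL' θ.b₀ θ.b₁ Mstar) U, (𝔬 x).Lap U = LcoS x.toKIdx bK (bg9Y (Matrix (Fin N) (Fin N) ℂ) (specialUnitaryUnits (Fin N)) x) (fun U => U) U)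
    -- rows 20–21 on n06-l g3's REPAIRED leaves `thm312Printed_of_stepRelH` ∕ `thm313Printed_of_stepRel`: walk letters `𝔬12`, numerics, (3.42) co-readings in the `Rel` species
    -- (`RelB` = same carrier block, multiplicity 2(d+1) discharged), (3.133) co-reading `hcoHR12` in the `Rel` species too, (3.47) `hcoG12`∕`hcoG13` fibre-free, model schemas, residuals, pins — reading the GENUINE Sect.-D letters
    {Z12 W12 : MemberY θ.d₆ θ.ℓ₆ θ.hd' θ.hL' θ.b₀ θ.b₁ Mstar → Type} [∀ x, Fintype (Z12 x)] [∀ x, Fintype (W12 x)]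
    (𝔬12 : ∀ x : MemberY θ.d₆ θ.ℓ₆ θ.hd' θ.hL' θ.b₀ θ.b₁ Mstar, B9Thm312Whole.Ops (geo9Y x) (bg9Y (Matrix (Fin N) (Fin N) ℂ) (specialUnitaryUnits (Fin N)) x) (XBK κK x.toKIdx) (XBK κK x.toKIdx) (Z12 x) (W12 x)) (H12 : MemberY θ.d₆ θ.ℓ₆ θ.hd' θ.hL' θ.b₀ θ.b₁ Mstar → Prop)
    (bH13 : ∀ x : MemberY θ.d₆ θ.ℓ₆ θ.hd' θ.hL' θ.b₀ θ.b₁ Mstar, BlockNorm (toB6 (geo9Y x) 1 (H12 x)) (W12 x → ℝ)) (θ12 θD12 r12 B12₀ δ12₀ δK12 σ12 ρ12 a12 M12 B12₁ δ12₁ B12₃ δ12₃ ρ13 α12 κ13 : ℝ) (Bβ12 Bε12 : ℝ → ℝ) (Bεβ12 : ℝ → ℝ → ℝ) (hθ12 : 0 ≤ θ12) (hθD12 : 0 ≤ θD12) (hr12 : 0 ≤ r12)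
    (hB12₀ : 0 ≤ B12₀) (hB12₃ : 0 ≤ B12₃) (hσ12 : 0 < σ12) (hρ12 : 0 < ρ12) (hρS12 : ρ12 ≤ δ12₀) (hρδ12 : ρ12 + σ12 ≤ δK12) (hρ₃12 : ρ12 + σ12 ≤ δ12₃) (ha12 : 0 < a12) (hM12 : 0 < M12) (hδ12₁ : 0 < δ12₁) (hα12 : 0 < α12) (hα12' : α12 ≤ 1 / 2) (hBβ12 : ∀ β, 0 ≤ Bβ12 β) (hBε12 : ∀ ε, 0 ≤ Bε12 ε)
    (hBεβ12 : ∀ ε β, 0 ≤ Bεβ12 ε β) (hκ13 : ∀ x, (bH13 x).κ ≤ κ13) (hρ13 : 0 < ρ13) (hρ13ρ : ρ13 + 3 * σ12 ≤ ρ12)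
    (hcoHR12 : ∀ (x : MemberY θ.d₆ θ.ℓ₆ θ.hd' θ.hL' θ.b₀ θ.b₁ Mstar) (U : (bg9Y (Matrix (Fin N) (Fin N) ℂ) (specialUnitaryUnits (Fin N)) x).Cfg), CoRealizesHRel ((opsYOfRecordV4E N θ.toStage3Params Mstar 𝔯 𝔢 𝔴 𝔈) x).H 0 U (θ.d₆ + 1) (RelB x.toKIdx) (𝔬12 x).blk (𝔬12 x).blkZ ((𝔬12 x).Hm U) ∧
      CoRealizesHRel ((opsYOfRecordV4E N θ.toStage3Params Mstar 𝔯 𝔢 𝔴 𝔈) x).H 1 U (θ.d₆ + 1) (RelB x.toKIdx) (𝔬12 x).blkY (𝔬12 x).blkZ ((𝔬12 x).D U ∘ₗ (𝔬12 x).Hm U) ∧ CoRealizesHRel ((opsYOfRecordV4E N θ.toStage3Params Mstar 𝔯 𝔢 𝔴 𝔈) x).H₁ 0 U (θ.d₆ + 1) (RelB x.toKIdx) (𝔬12 x).blk (𝔬12 x).blkZ ((𝔬12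
      x).H1m U) ∧ CoRealizesHRel ((opsYOfRecordV4E N θ.toStage3Params Mstar 𝔯 𝔢 𝔴 𝔈) x).H₁ 1 U (θ.d₆ + 1) (RelB x.toKIdx) (𝔬12 x).blkY (𝔬12 x).blkZ ((𝔬12 x).D U ∘ₗ (𝔬12 x).H1m U))
    (hmodel12 : ∀ x : MemberY θ.d₆ θ.ℓ₆ θ.hd' θ.hL' θ.b₀ θ.b₁ Mstar, M12 ≤ (geo9Y x).M → ∀ α₀ : ℝ, 0 < α₀ → (geo9Y x).M * α₀ ≤ a12 → ∀ U : (bg9Y (Matrix (Fin N) (Fin N) ℂ) (specialUnitaryUnits (Fin N)) x).Cfg, (bg9Y (Matrix (Fin N) (Fin N) ℂ) (specialUnitaryUnits (Fin N)) x).Reg335 c35Y α₀ U →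
      (bg9Y (Matrix (Fin N) (Fin N) ℂ) (specialUnitaryUnits (Fin N)) x).Reg336 c35Y α₀ U → Thm33G0 (𝔬12 x) 1 (H12 x) B12₀ δ12₀ U ∧ B9Thm312Whole.Step (𝔬12 x) 1 (H12 x) (fun y => (geo9Y_len_pos x y).le) 1 (θ12 * ((geo9Y x).M * α₀)) δK12 U ∧ B9Thm312Whole.Step (𝔬12 x) 1 (H12 x) (fun y =>
      (geo9Y_len_pos x y).le) 2 (θ12 * ((geo9Y x).M * α₀)) δK12 U ∧ FormSmall (𝔬12 x) (r12 * ((geo9Y x).M * α₀)) U ∧ B9Thm312Whole.Identities (𝔬12 x) U)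
    (hleft12 : ∀ x : MemberY θ.d₆ θ.ℓ₆ θ.hd' θ.hL' θ.b₀ θ.b₁ Mstar, M12 ≤ (geo9Y x).M → ∀ α₀ : ℝ, 0 < α₀ → (geo9Y x).M * α₀ ≤ a12 → ∀ U : (bg9Y (Matrix (Fin N) (Fin N) ℂ) (specialUnitaryUnits (Fin N)) x).Cfg, (bg9Y (Matrix (Fin N) (Fin N) ℂ) (specialUnitaryUnits (Fin N)) x).Reg335 c35Y α₀ U → (bg9Y
      (Matrix (Fin N) (Fin N) ℂ) (specialUnitaryUnits (Fin N)) x).Reg336 c35Y α₀ U → LeftStep (𝔬12 x) 1 (H12 x) (fun y => (geo9Y_len_pos x y).le) B12₀ δ12₀ (θD12 * ((geo9Y x).M * α₀)) δK12 U)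
    (hlettersH12 : ∀ x : MemberY θ.d₆ θ.ℓ₆ θ.hd' θ.hL' θ.b₀ θ.b₁ Mstar, M12 ≤ (geo9Y x).M → ∀ α₀ : ℝ, 0 < α₀ → (geo9Y x).M * α₀ ≤ a12 → ∀ U : (bg9Y (Matrix (Fin N) (Fin N) ℂ) (specialUnitaryUnits (Fin N)) x).Cfg, (bg9Y (Matrix (Fin N) (Fin N) ℂ) (specialUnitaryUnits (Fin N)) x).Reg335 c35Y α₀ U →
      (bg9Y (Matrix (Fin N) (Fin N) ℂ) (specialUnitaryUnits (Fin N)) x).Reg336 c35Y α₀ U → LettersH (𝔬12 x) 1 (H12 x) ⟨geo9Y_dist_triangle x, geo9Y_dist_comm x, geo9K_dist_nonneg x.toKIdx, geo9Y_len_pos x⟩ B12₃ δ12₃ U)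
    (hres12 : ∀ x : MemberY θ.d₆ θ.ℓ₆ θ.hd' θ.hL' θ.b₀ θ.b₁ Mstar, M12 ≤ (geo9Y x).M → ∀ α₀ : ℝ, 0 < α₀ → (geo9Y x).M * α₀ ≤ a12 → ∀ U : (bg9Y (Matrix (Fin N) (Fin N) ℂ) (specialUnitaryUnits (Fin N)) x).Cfg, (bg9Y (Matrix (Fin N) (Fin N) ℂ) (specialUnitaryUnits (Fin N)) x).Reg335 c35Y α₀ U → (bg9Y
      (Matrix (Fin N) (Fin N) ℂ) (specialUnitaryUnits (Fin N)) x).Reg336 c35Y α₀ U → (∀ K ∈ [((opsYOfRecordV4E N θ.toStage3Params Mstar 𝔯 𝔢 𝔴 𝔈) x).GD, ((opsYOfRecordV4E N θ.toStage3Params Mstar 𝔯 𝔢 𝔴 𝔈) x).G₁], L2Block K B12₁ δ12₁ U ∧ B9.Ineq343_345 K Bβ12 Bε12 Bεβ12 δ12₁ U) ∧ (∀ Hk' ∈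
      [((opsYOfRecordV4E N θ.toStage3Params Mstar 𝔯 𝔢 𝔴 𝔈) x).H, ((opsYOfRecordV4E N θ.toStage3Params Mstar 𝔯 𝔢 𝔴 𝔈) x).H₁], ∀ (β : ℝ) (ζ : (geo9Y x).Cut) (y y' : (geo9Y x).Site), 0 ≤ β → β < 1 → (geo9Y x).cutInT ζ y → Hk'.h U β ζ y' ≤ Bβ12 β * (geo9Y x).cutH β ζ * ((geo9Y x).len y) ^ (-(1 + β)) *
      ((geo9Y x).len y') ^ (-((θ.d₆ + 1 : ℕ) : ℝ)) * Real.exp (-(δ12₁ / 2 * (geo9Y x).dist y y'))))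
    (hpinE : ∀ x : MemberY θ.d₆ θ.ℓ₆ θ.hd' θ.hL' θ.b₀ θ.b₁ Mstar, ((opsYOfRecordV4E N θ.toStage3Params Mstar 𝔯 𝔢 𝔴 𝔈) x).HasRWExp = HasRWExpOfOps (𝔬12 x))
    (hpinH : ∀ x : MemberY θ.d₆ θ.ℓ₆ θ.hd' θ.hL' θ.b₀ θ.b₁ Mstar, ((opsYOfRecordV4E N θ.toStage3Params Mstar 𝔯 𝔢 𝔴 𝔈) x).HasRWExpH = HasRWExpHOfOps (𝔬12 x))
    (hpinK : ∀ x : MemberY θ.d₆ θ.ℓ₆ θ.hd' θ.hL' θ.b₀ θ.b₁ Mstar, ((opsYOfRecordV4E N θ.toStage3Params Mstar 𝔯 𝔢 𝔴 𝔈) x).PosDefK = PosDefKOfOps (𝔬12 x))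
    -- PINS of Theorems 3.12–3.13's walk letters to the coordinate models of the GENUINE `GD G₁ GG` — the nine `CoRealizesRel` and nine `CoReadsGlob` co-readings are theorems
    (hblk12 : ∀ x : MemberY θ.d₆ θ.ℓ₆ θ.hd' θ.hL' θ.b₀ θ.b₁ Mstar, (𝔬12 x).blk = blkBK x.toKIdx (bI x)) (hblkY12 : ∀ x : MemberY θ.d₆ θ.ℓ₆ θ.hd' θ.hL' θ.b₀ θ.b₁ Mstar, (𝔬12 x).blkY = blkBK x.toKIdx (bI x))
    (hGco12 : ∀ (x : MemberY θ.d₆ θ.ℓ₆ θ.hd' θ.hL' θ.b₀ θ.b₁ Mstar) (U : (bg9Y (Matrix (Fin N) (Fin N) ℂ) (specialUnitaryUnits (Fin N)) x).Cfg), (𝔬12 x).G U = GcoK x.toKIdx bK (bg9Y (Matrix (Fin N) (Fin N) ℂ) (specialUnitaryUnits (Fin N)) x) (fun U => U) (lettersYOfRecordV4 N θ.toStage3Params Mstar 𝔯 x).GD U)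
    (hG1co12 : ∀ (x : MemberY θ.d₆ θ.ℓ₆ θ.hd' θ.hL' θ.b₀ θ.b₁ Mstar) (U : (bg9Y (Matrix (Fin N) (Fin N) ℂ) (specialUnitaryUnits (Fin N)) x).Cfg), (𝔬12 x).G1 U = GcoK x.toKIdx bK (bg9Y (Matrix (Fin N) (Fin N) ℂ) (specialUnitaryUnits (Fin N)) x) (fun U => U) (lettersYOfRecordV4 N θ.toStage3Params Mstar 𝔯 x).G₁ U)
    (hGGco12 : ∀ (x : MemberY θ.d₆ θ.ℓ₆ θ.hd' θ.hL' θ.b₀ θ.b₁ Mstar) (U : (bg9Y (Matrix (Fin N) (Fin N) ℂ) (specialUnitaryUnits (Fin N)) x).Cfg), (𝔬12 x).GG U = GcoK x.toKIdx bK (bg9Y (Matrix (Fin N) (Fin N) ℂ) (specialUnitaryUnits (Fin N)) x) (fun U => U) (lettersYOfRecordV4 N θ.toStage3Params Mstar 𝔯 x).GG U)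
    (hDco12 : ∀ (x : MemberY θ.d₆ θ.ℓ₆ θ.hd' θ.hL' θ.b₀ θ.b₁ Mstar) (U : (bg9Y (Matrix (Fin N) (Fin N) ℂ) (specialUnitaryUnits (Fin N)) x).Cfg), (𝔬12 x).D U = DcoK x.toKIdx bK (bg9Y (Matrix (Fin N) (Fin N) ℂ) (specialUnitaryUnits (Fin N)) x) (fun U => U) U)
    (hDsco12 : ∀ (x : MemberY θ.d₆ θ.ℓ₆ θ.hd' θ.hL' θ.b₀ θ.b₁ Mstar) (U : (bg9Y (Matrix (Fin N) (Fin N) ℂ) (specialUnitaryUnits (Fin N)) x).Cfg), (𝔬12 x).Dstar U = DscoK x.toKIdx bK (bg9Y (Matrix (Fin N) (Fin N) ℂ) (specialUnitaryUnits (Fin N)) x) (fun U => U) U)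
    (hletters13 : ∀ x : MemberY θ.d₆ θ.ℓ₆ θ.hd' θ.hL' θ.b₀ θ.b₁ Mstar, M12 ≤ (geo9Y x).M → ∀ α₀ : ℝ, 0 < α₀ → (geo9Y x).M * α₀ ≤ a12 → ∀ U : (bg9Y (Matrix (Fin N) (Fin N) ℂ) (specialUnitaryUnits (Fin N)) x).Cfg, (bg9Y (Matrix (Fin N) (Fin N) ℂ) (specialUnitaryUnits (Fin N)) x).Reg335 c35Y α₀ U →
      (bg9Y (Matrix (Fin N) (Fin N) ℂ) (specialUnitaryUnits (Fin N)) x).Reg336 c35Y α₀ U → Letters313 (𝔬12 x) 1 (H12 x) ⟨geo9Y_dist_triangle x, geo9Y_dist_comm x, geo9K_dist_nonneg x.toKIdx, geo9Y_len_pos x⟩ B12₃ δ12₃ U)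
    (hlettersD13 : ∀ x : MemberY θ.d₆ θ.ℓ₆ θ.hd' θ.hL' θ.b₀ θ.b₁ Mstar, M12 ≤ (geo9Y x).M → ∀ α₀ : ℝ, 0 < α₀ → (geo9Y x).M * α₀ ≤ a12 → ∀ U : (bg9Y (Matrix (Fin N) (Fin N) ℂ) (specialUnitaryUnits (Fin N)) x).Cfg, (bg9Y (Matrix (Fin N) (Fin N) ℂ) (specialUnitaryUnits (Fin N)) x).Reg335 c35Y α₀ U →
      (bg9Y (Matrix (Fin N) (Fin N) ℂ) (specialUnitaryUnits (Fin N)) x).Reg336 c35Y α₀ U → Letters313D (𝔬12 x) 1 (H12 x) ⟨geo9Y_dist_triangle x, geo9Y_dist_comm x, geo9K_dist_nonneg x.toKIdx, geo9Y_len_pos x⟩ B12₃ δ12₃ (bH13 x) U)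
    (hres13 : ∀ x : MemberY θ.d₆ θ.ℓ₆ θ.hd' θ.hL' θ.b₀ θ.b₁ Mstar, M12 ≤ (geo9Y x).M → ∀ α₀ : ℝ, 0 < α₀ → (geo9Y x).M * α₀ ≤ a12 → ∀ U : (bg9Y (Matrix (Fin N) (Fin N) ℂ) (specialUnitaryUnits (Fin N)) x).Cfg, (bg9Y (Matrix (Fin N) (Fin N) ℂ) (specialUnitaryUnits (Fin N)) x).Reg335 c35Y α₀ U → (bg9Y
      (Matrix (Fin N) (Fin N) ℂ) (specialUnitaryUnits (Fin N)) x).Reg336 c35Y α₀ U → L2Block ((opsYOfRecordV4E N θ.toStage3Params Mstar 𝔯 𝔢 𝔴 𝔈) x).GG B12₁ δ12₁ U ∧ B9.Ineq343_345 ((opsYOfRecordV4E N θ.toStage3Params Mstar 𝔯 𝔢 𝔴 𝔈) x).GG Bβ12 Bε12 Bεβ12 δ12₁ U)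
    -- rows 22–23 on n06-m g3's face `thm314_pair_opsYOfRecordDE` (Thm 3.14 global ∕ localised for the GENUINE `Kdiff = KdiffY`, the cancellation reading PROVED):
    -- the two sequences' walk-term letters with their Thm-3.10 all-norms leaves read through `kernelFamilyB`, localisation data + laws, walk sets, the located approximation identity
    {E14₁ E14₂ : ∀ x : MemberY θ.d₆ θ.ℓ₆ θ.hd' θ.hL' θ.b₀ θ.b₁ Mstar, B9.RWExpansion (geo9Y x) (bg9Y (Matrix (Fin N) (Fin N) ℂ) (specialUnitaryUnits (Fin N)) x)} (T14₁ : ∀ x : MemberY θ.d₆ θ.ℓ₆ θ.hd' θ.hL' θ.b₀ θ.b₁ Mstar, (E14₁ x).Walk → BondOpY (Matrix (Fin N) (Fin N) ℂ) x.toKIdx)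
    (T14₂ : ∀ x : MemberY θ.d₆ θ.ℓ₆ θ.hd' θ.hL' θ.b₀ θ.b₁ Mstar, (E14₂ x).Walk → BondOpY (Matrix (Fin N) (Fin N) ℂ) x.toKIdx) (X14₁ : ∀ x : MemberY θ.d₆ θ.ℓ₆ θ.hd' θ.hL' θ.b₀ θ.b₁ Mstar, (E14₁ x).Walk → ℕ → (geo9Y x).Site → Prop)
    (M14₁ : ∀ x : MemberY θ.d₆ θ.ℓ₆ θ.hd' θ.hL' θ.b₀ θ.b₁ Mstar, (E14₁ x).Walk → ℕ → Prop) (X14₂ : ∀ x : MemberY θ.d₆ θ.ℓ₆ θ.hd' θ.hL' θ.b₀ θ.b₁ Mstar, (E14₂ x).Walk → ℕ → (geo9Y x).Site → Prop) (M14₂ : ∀ x : MemberY θ.d₆ θ.ℓ₆ θ.hd' θ.hL' θ.b₀ θ.b₁ Mstar, (E14₂ x).Walk → ℕ → Prop)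
    (diam14 : MemberY θ.d₆ θ.ℓ₆ θ.hd' θ.hL' θ.b₀ θ.b₁ Mstar → ℝ) (r14 : ℝ) (hr14 : ∀ x, diam14 x ≤ r14)
    (near14₁ : ∀ (x : MemberY θ.d₆ θ.ℓ₆ θ.hd' θ.hL' θ.b₀ θ.b₁ Mstar) ω m p, M14₁ x ω m → X14₁ x ω m p → ∃ q, q ∈ OmegaC x.D x.D' ∧ tdistK (ℓ := θ.ℓ₆) (Mh := x.Mh) (k := x.k) (P := x.P') (kLab x p) q ≤ diam14 x)
    (first14₁ : ∀ (x : MemberY θ.d₆ θ.ℓ₆ θ.hd' θ.hL' θ.b₀ θ.b₁ Mstar) ω y, (E14₁ x).first ω y → X14₁ x ω 0 y)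
    (chain14₁ : ∀ (x : MemberY θ.d₆ θ.ℓ₆ θ.hd' θ.hL' θ.b₀ θ.b₁ Mstar) ω y y', (E14₁ x).first ω y → (E14₁ x).last ω y' → ∃ l : List (geo9Y x).Site, l.length = (E14₁ x).wlen ω ∧ (∀ (m : ℕ) (hm : m < l.length), X14₁ x ω (m + 1) (l[m])) ∧ B9Thm314.chainSum (geo9Y x).dist y l y' ≤ (E14₁ x).wdist ω y y')
    (near14₂ : ∀ (x : MemberY θ.d₆ θ.ℓ₆ θ.hd' θ.hL' θ.b₀ θ.b₁ Mstar) ω m p, M14₂ x ω m → X14₂ x ω m p → ∃ q, q ∈ OmegaC x.D x.D' ∧ tdistK (ℓ := θ.ℓ₆) (Mh := x.Mh) (k := x.k) (P := x.P') (kLab x p) q ≤ diam14 x)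
    (first14₂ : ∀ (x : MemberY θ.d₆ θ.ℓ₆ θ.hd' θ.hL' θ.b₀ θ.b₁ Mstar) ω y, (E14₂ x).first ω y → X14₂ x ω 0 y)
    (chain14₂ : ∀ (x : MemberY θ.d₆ θ.ℓ₆ θ.hd' θ.hL' θ.b₀ θ.b₁ Mstar) ω y y', (E14₂ x).first ω y → (E14₂ x).last ω y' → ∃ l : List (geo9Y x).Site, l.length = (E14₂ x).wlen ω ∧ (∀ (m : ℕ) (hm : m < l.length), X14₂ x ω (m + 1) (l[m])) ∧ B9Thm314.chainSum (geo9Y x).dist y l y' ≤ (E14₂ x).wdist ω y y')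
    (h14₁ : Thm310AllNormsPrinted c35Y geo9Y (bg9Y (Matrix (Fin N) (Fin N) ℂ) (specialUnitaryUnits (Fin N))) E14₁ (fun x ω => kernelFamilyB x.toKIdx (bg9Y (Matrix (Fin N) (Fin N) ℂ) (specialUnitaryUnits (Fin N)) x) (fun U => U) (T14₁ x ω) (lettersYOfRecordV4 N θ.toStage3Params Mstar 𝔯 x).parB))
    (h14₂ : Thm310AllNormsPrinted c35Y geo9Y (bg9Y (Matrix (Fin N) (Fin N) ℂ) (specialUnitaryUnits (Fin N))) E14₂ (fun x ω => kernelFamilyB x.toKIdx (bg9Y (Matrix (Fin N) (Fin N) ℂ) (specialUnitaryUnits (Fin N)) x) (fun U => U) (T14₂ x ω) (lettersYOfRecordV4 N θ.toStage3Params Mstar 𝔯 x).parB))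
    (W14₁ : ∀ x : MemberY θ.d₆ θ.ℓ₆ θ.hd' θ.hL' θ.b₀ θ.b₁ Mstar, ℕ → (geo9Y x).Site → (geo9Y x).Site → Finset (E14₁ x).Walk) (W14₂ : ∀ x : MemberY θ.d₆ θ.ℓ₆ θ.hd' θ.hL' θ.b₀ θ.b₁ Mstar, ℕ → (geo9Y x).Site → (geo9Y x).Site → Finset (E14₂ x).Walk) (hW14₁ : ∀ x, WalkSetsSpec (E14₁ x) (W14₁ x))
    (hW14₂ : ∀ x, WalkSetsSpec (E14₂ x) (W14₂ x)) (hcnt14₁ : WalkWeightsSummable geo9Y (bg9Y (Matrix (Fin N) (Fin N) ℂ) (specialUnitaryUnits (Fin N))) E14₁ W14₁) (hcnt14₂ : WalkWeightsSummable geo9Y (bg9Y (Matrix (Fin N) (Fin N) ℂ) (specialUnitaryUnits (Fin N))) E14₂ W14₂)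
    (hexp14 : ∀ (x : MemberY θ.d₆ θ.ℓ₆ θ.hd' θ.hL' θ.b₀ θ.b₁ Mstar) (U : (bg9Y (Matrix (Fin N) (Fin N) ℂ) (specialUnitaryUnits (Fin N)) x).Cfg), (E14₁ x).Converges U ∧ (E14₂ x).Converges U → ExpansionReads x.toKIdx (B := bg9Y (Matrix (Fin N) (Fin N) ℂ) (specialUnitaryUnits (Fin N)) x) (fun U => U)
      (lettersYOfRecordV4 N θ.toStage3Params Mstar 𝔯 x).Kdiff (pairOp (locDataY x (E14₁ x) (X14₁ x) (M14₁ x) (diam14 x)).Touches (locData₂ (locDataY x (E14₁ x) (X14₁ x) (M14₁ x) (diam14 x)) (X14₂ x) (M14₂ x)).Touches (T14₁ x) (T14₂ x)) (pairWalkSets (W14₁ x) (W14₂ x) (locDataY x (E14₁ x) (X14₁ x) (M14₁ x) (diam14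
      x)).Touches (locData₂ (locDataY x (E14₁ x) (X14₁ x) (M14₁ x) (diam14 x)) (X14₂ x) (M14₂ x)).Touches) U)
    -- row 25 on n06-i g6's DERIVED face `stmt349Printed_site_of_blockSchemas` ((3.49) for the GENUINE `P = I − R(U)` «using again Lemma 2.1»): block-complete Thm 3.1∕3.2-type inputs
    (h31S : Thm31SiteSchemas (Matrix (Fin N) (Fin N) ℂ) (specialUnitaryUnits (Fin N)) c35Y (lettersYOfRecordV4 N θ.toStage3Params Mstar 𝔯)) (h32B : Thm32BlkSchema (Matrix (Fin N) (Fin N) ℂ) (specialUnitaryUnits (Fin N)) c35Y (lettersYOfRecordV4 N θ.toStage3Params Mstar 𝔯))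
    -- row 26 DISPLAYED WHOLE — LOCATED FALSE AS INSTANTIATED (n06-i g7, pub-ymgap INBOX l.17069, FILE O `B9Eq3132FlatReadingAtOne`): (3.132) read through def-Y's FLAT `siteKernelOfOp` of
    -- `(QGQ*)⁻¹` fails at U = 1 by unbounded powers of Lᵏ ([4] (2.142)∕(2.149), units); the certificate is CONDITIONAL ON THIS LOCATED-FALSE ROW until def-Y's weighted reading of
    -- `QGQinv`∕`QG1Qinv` lands (then: re-instantiate, and n06-i's re-derived face supplies it) — displayed whole so that NOTHING is derived ex falso from estimate binders here
    (s3132 : B9.Stmt3132Printed (θ.d₆ + 1) c35Y geo9Y (bg9Y (Matrix (Fin N) (Fin N) ℂ) (specialUnitaryUnits (Fin N))) (fun x => ((opsYOfRecordV4E N θ.toStage3Params Mstar 𝔯 𝔢 𝔴 𝔈) x).QGQinv) (fun x => ((opsYOfRecordV4E N θ.toStage3Params Mstar 𝔯 𝔢 𝔴 𝔈) x).QG1Qinv))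
    -- row 24 on n06-m g4's face OF RECORD `B9Thm315WholeSectERepOn.t315_opsYOfRecordV4E_of_3185_on` (p508154): Thm 3.15 through the (3.185) SLOT for the GENUINE `C^{(k)}(Λ;U)` —
    -- under the printed prefix: the (3.185) identity, the expansion clause of `𝔴`, the outer locality (3.169) and the decay of `QG̃₂Q*` between Λ-bonds (G-B9-10); (3.187) DERIVED (`B₀ = B₁e^{2δ₁r}m_Em_F`)
    {a₀E δ₁E B₁E rE mE mF : ℝ} (ha₀E : 0 < a₀E) (hδ₁E : 0 < δ₁E) (hB₁E : 0 < B₁E) (hmE : 0 < mE) (hmF : 0 < mF)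
    (hE : ∀ (x : MemberY θ.d₆ θ.ℓ₆ θ.hd' θ.hL' θ.b₀ θ.b₁ Mstar) (α₀ : ℝ), 0 < α₀ → (geo9Y x).M * α₀ ≤ a₀E → ∀ U : (bg9Y (Matrix (Fin N) (Fin N) ℂ) (specialUnitaryUnits (Fin N)) x).Cfg, (bg9Y (Matrix (Fin N) (Fin N) ℂ) (specialUnitaryUnits (Fin N)) x).Reg335 c35Y α₀ U → (bg9Y (Matrix (Fin N) (Fin N) ℂ) (specialUnitaryUnits (Fin N)) x).Reg336 c35Y α₀ U →
      givenBy3185Y x (lettersYOfRecordV4 N θ.toStage3Params Mstar 𝔯 x) (𝔢 x) U ∧ hasRWExpCY (𝔴 x) U δ₁E ∧ LocalOuterY x (𝔢 x) rE mE mF U ∧ DecayMidOnY x (lettersYOfRecordV4 N θ.toStage3Params Mstar 𝔯 x) (𝔢 x) B₁E U δ₁E)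
    (P : B12.RunParams) : Dag.B9_main (leavesP w P) := by
  have hL1 : (1 : ℝ) ≤ ((θ.ℓ₆ + 1 : ℕ) : ℝ) := by exact_mod_cast Nat.succ_le_succ (Nat.zero_le _)
  have t311 := t311_of_pins_opsYOfLetters θ.toStage3Params Mstar (lettersYOfRecordV4 N θ.toStage3Params Mstar 𝔯) 𝔈 𝔔 θ311 a311 M311 ha311 hM311
    (fun _ => rfl) (fun _ => rfl) h311Y hPD
  have t315 := t315_opsYOfRecordV4E_of_3185_on N θ.toStage3Params Mstar 𝔯 𝔢 𝔴 𝔈 ha₀E hδ₁E hB₁E hmE hmF hE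
  obtain ⟨t314, t314loc⟩ : B9.Thm314Printed c35Y geo9Y (bg9Y (Matrix (Fin N) (Fin N) ℂ) (specialUnitaryUnits (Fin N))) (fun x => ((opsYOfRecordV4E N θ.toStage3Params Mstar 𝔯 𝔢 𝔴 𝔈) x).Kdiff) dOmegaY ∧
      B9Thm314.Thm314LocalPrinted c35Y geo9Y (bg9Y (Matrix (Fin N) (Fin N) ℂ) (specialUnitaryUnits (Fin N))) (fun x => ((opsYOfRecordV4E N θ.toStage3Params Mstar 𝔯 𝔢 𝔴 𝔈) x).Kdiff) OmKY dOmegaY :=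
    thm314_pair_layerOfLetters (lettersYOfRecordV4 N θ.toStage3Params Mstar 𝔯) 𝔈 T14₁ T14₂ (fun x => locDataY x (E14₁ x) (X14₁ x) (M14₁ x) (diam14 x)) X14₂ M14₂
      (fun x => locDataY_laws x (E14₁ x) (near14₁ x) (first14₁ x) (chain14₁ x)) (fun x => locDataY_laws x (E14₂ x) (near14₂ x) (first14₂ x) (chain14₂ x)) r14 hr14
      (fun x => modelSignsOn_geo9K x.toKIdx) (fun x y y' => dOmegaY_nonneg x y y') h14₁ h14₂ W14₁ W14₂ hW14₁ hW14₂ hcnt14₁ hcnt14₂ hexp14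
  have hGp := hGp_opsYOfLetters_holds N θ.toStage3Params Mstar (lettersYOfRecordV4 N θ.toStage3Params Mstar 𝔯) 𝔈
  have hGA := hGA_opsYOfLetters N θ.toStage3Params Mstar (lettersYOfRecordV4 N θ.toStage3Params Mstar 𝔯) 𝔈
  obtain ⟨t39, hksum⟩ := t39_hksum_of_pins_opsYOfLetters θ.toStage3Params Mstar (lettersYOfRecordV4 N θ.toStage3Params Mstar 𝔯) 𝔈 𝔬39 rd39 α39 α' r39 δ39
    θ39 B39 N39 a39 M39 h39α h39α1 hα'0 hα'1 hr39 hrδ39 hθ39 hB39 hN39 ha39 hM39 hst39 hloc39 h39 (fun _ => rfl) hblk39 hL39 hEK39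
  have hsat : ∀ (x : MemberY θ.d₆ θ.ℓ₆ θ.hd' θ.hL' θ.b₀ θ.b₁ Mstar) (n : Fin 4) (B' δ' : ℝ),
      (∀ a a' b, RelB x.toKIdx a a' → maj342 (geo9Y x) n B' δ' a b = maj342 (geo9Y x) n B' δ' a' b) ∧
      (∀ a b b', RelB x.toKIdx b b' → maj342 (geo9Y x) n B' δ' a b = maj342 (geo9Y x) n B' δ' a b') :=
    fun x n B' δ' => ⟨fun a a' b h => maj342_relB_left x.toKIdx n B' δ' a a' b h, fun a b b' h => maj342_relB_right x.toKIdx n B' δ' a b b' h⟩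
  have hmult : ∀ (x : MemberY θ.d₆ θ.ℓ₆ θ.hd' θ.hL' θ.b₀ θ.b₁ Mstar) (y' : (geo9Y x).Site),
      (Finset.univ.filter (fun y'' : (geo9Y x).Site => RelB x.toKIdx y'' y')).card ≤ 2 * (θ.d₆ + 1) := fun x y' => by
    refine le_trans (Finset.card_le_card fun c hc => ?_) (card_sameCarrier_le_kIdx x.toKIdx y')
    exact Finset.mem_filter.2 ⟨@Finset.mem_univ _ (_) c, (Finset.mem_filter.1 hc).2⟩
  have hRdist : ∀ (x : MemberY θ.d₆ θ.ℓ₆ θ.hd' θ.hL' θ.b₀ θ.b₁ Mstar) (a a' b : (geo9Y x).Site), RelB x.toKIdx a a' → (geo9Y x).dist a b = (geo9Y x).dist a' b :=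
    fun x a a' b h => dist_eq_of_relB x.toKIdx h (relB_refl x.toKIdx b)
  have hRlen : ∀ (x : MemberY θ.d₆ θ.ℓ₆ θ.hd' θ.hL' θ.b₀ θ.b₁ Mstar) (a a' : (geo9Y x).Site), RelB x.toKIdx a a' → (geo9Y x).len a = (geo9Y x).len a' :=
    fun x a a' h => len_eq_of_relB x.toKIdx h
  -- the bond-sector co-readings of rows 19–21 are THEOREMS on the coordinate model (`B9CoReadingCoords`, `B9CoReadingCoordsGlob`)
  have hS := fun (x : MemberY θ.d₆ θ.ℓ₆ θ.hd' θ.hL' θ.b₀ θ.b₁ Mstar) (U : (bg9Y (Matrix (Fin N) (Fin N) ℂ) (specialUnitaryUnits (Fin N)) x).Cfg) => site_coReadings_of_pins x bK (hβI x) (hlev x) (lettersYOfRecordV4 N θ.toStage3Params Mstar 𝔯 x).Gp (lettersYOfRecordV4 N θ.toStage3Params Mstar 𝔯 x).parS (𝔬 x) (hblkS x) (hblkYS x) (hGpS x) (hDS x) (hDsS x) (hLapS x) U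
  have hco0 := fun x U => (hS x U).1; have hco1 := fun x U => (hS x U).2.1; have hco2 := fun x U => (hS x U).2.2.1; have hco3 := fun x U => (hS x U).2.2.2.1
  have hgl0 := fun x U => (hS x U).2.2.2.2.1; have hgl1 := fun x U => (hS x U).2.2.2.2.2.1; have hgl2 := fun x U => (hS x U).2.2.2.2.2.2.1; have hgl3 := fun x U => (hS x U).2.2.2.2.2.2.2
  have hcoA0 : ∀ (x : MemberY θ.d₆ θ.ℓ₆ θ.hd' θ.hL' θ.b₀ θ.b₁ Mstar) (U : (bg9Y (Matrix (Fin N) (Fin N) ℂ) (specialUnitaryUnits (Fin N)) x).Cfg), CoRealizesRel ((opsYOfRecordV4E N θ.toStage3Params Mstar 𝔯 𝔢 𝔴 𝔈) x).GA 0 U (RelB x.toKIdx) (𝔬A x).blk (𝔬A x).blk (evBK x.toKIdx) ((𝔬A x).G U) := fun x U => by have h' := coRealizesRel_kernelFamilyB_coords_zero x.toKIdx bK (bg9Y (Matrix (Fin N) (Fin N) ℂ) (specialUnitaryUnits (Fin N)) x) (fun U => U) (lettersYOfRecordV4 N θ.toStage3Params Mstar 𝔯 x).GA (lettersYOfRecordV4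 N θ.toStage3Params Mstar 𝔯 x).parB U (hβI x); rw [← hblkA x, ← hGcoA x U] at h'; exact h'
  have hcoA1 : ∀ (x : MemberY θ.d₆ θ.ℓ₆ θ.hd' θ.hL' θ.b₀ θ.b₁ Mstar) (U : (bg9Y (Matrix (Fin N) (Fin N) ℂ) (specialUnitaryUnits (Fin N)) x).Cfg), CoRealizesRel ((opsYOfRecordV4E N θ.toStage3Params Mstar 𝔯 𝔢 𝔴 𝔈) x).GA 1 U (RelB x.toKIdx) (𝔬A x).blkY (𝔬A x).blk (evBK x.toKIdx) ((𝔬A x).D U ∘ₗ (𝔬A x).G U) := fun x U => by have h' := coRealizesRel_kernelFamilyB_coords_one x.toKIdx bK (bg9Y (Matrix (Fin N) (Fin N) ℂ) (specialUnitaryUnits (Fin N)) x) (fun U => U) (lettersYOfRecordV4 N θ.toStage3Params Mstar 𝔯 x).GA (lettersYOfRecordV4 N θ.toStage3Params Mstar 𝔯 x).parB U (hβI x); nth_rw 1 [← hblkYA x] at h'; rw [← hblkA x, ← hDcoA x U, ← hGcoA x U] at h'; exact h'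
  have hcoA2 : ∀ (x : MemberY θ.d₆ θ.ℓ₆ θ.hd' θ.hL' θ.b₀ θ.b₁ Mstar) (U : (bg9Y (Matrix (Fin N) (Fin N) ℂ) (specialUnitaryUnits (Fin N)) x).Cfg), CoRealizesRel ((opsYOfRecordV4E N θ.toStage3Params Mstar 𝔯 𝔢 𝔴 𝔈) x).GA 2 U (RelB x.toKIdx) (𝔬A x).blk (𝔬A x).blkY (evBK x.toKIdx) ((𝔬A x).G U ∘ₗ (𝔬A x).Dstar U) := fun x U => by have h' := coRealizesRel_kernelFamilyB_coords_two x.toKIdx bK (bg9Y (Matrix (Fin N) (Fin N) ℂ) (specialUnitaryUnits (Fin N)) x) (fun U => U) (lettersYOfRecordV4 N θ.toStage3Params Mstar 𝔯 x).GA (lettersYOfRecordV4 N θ.toStage3Params Mstar 𝔯 x).parB U (hβI x); nth_rw 2 [← hblkYA x] at h'; rw [← hblkA x, ← hDscoA x U, ← hGcoA x U] at h'; exact h'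
  have hcoA3 : ∀ (x : MemberY θ.d₆ θ.ℓ₆ θ.hd' θ.hL' θ.b₀ θ.b₁ Mstar) (U : (bg9Y (Matrix (Fin N) (Fin N) ℂ) (specialUnitaryUnits (Fin N)) x).Cfg), CoRealizesRel ((opsYOfRecordV4E N θ.toStage3Params Mstar 𝔯 𝔢 𝔴 𝔈) x).GA 3 U (RelB x.toKIdx) (𝔬A x).blk (𝔬A x).blk (evBK x.toKIdx) ((𝔬A x).Lap U ∘ₗ (𝔬A x).G U) := fun x U => by have h' := coRealizesRel_kernelFamilyB_coords_three x.toKIdx bK (bg9Y (Matrix (Fin N) (Fin N) ℂ) (specialUnitaryUnits (Fin N)) x) (fun U => U) (lettersYOfRecordV4 N θ.toStage3Params Mstar 𝔯 x).GA (lettersYOfRecordV4 N θ.toStage3Params Mstar 𝔯 x).parB U (hβI x); rw [← hblkA x, ← hLcoA x U, ← hGcoA x U] at h'; exact h'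
  have hglA0 : ∀ (x : MemberY θ.d₆ θ.ℓ₆ θ.hd' θ.hL' θ.b₀ θ.b₁ Mstar) (U : (bg9Y (Matrix (Fin N) (Fin N) ℂ) (specialUnitaryUnits (Fin N)) x).Cfg), GlobReads ((opsYOfRecordV4E N θ.toStage3Params Mstar 𝔯 𝔢 𝔴 𝔈) x).GA 0 U (𝔬A x).blk (𝔬A x).blk (evBK x.toKIdx) ((𝔬A x).G U) := fun x U => by have h' := globReads_kernelFamilyB_coords_zero x.toKIdx bK (bg9Y (Matrix (Fin N) (Fin N) ℂ) (specialUnitaryUnits (Fin N)) x) (fun U => U) (lettersYOfRecordV4 N θ.toStage3Params Mstar 𝔯 x).GA (lettersYOfRecordV4 N θ.toStage3Params Mstar 𝔯 x).parB U (hlev x); rw [← hblkA x, ← hGcoA x U] at h'; exact h'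
  have hglA1 : ∀ (x : MemberY θ.d₆ θ.ℓ₆ θ.hd' θ.hL' θ.b₀ θ.b₁ Mstar) (U : (bg9Y (Matrix (Fin N) (Fin N) ℂ) (specialUnitaryUnits (Fin N)) x).Cfg), GlobReads ((opsYOfRecordV4E N θ.toStage3Params Mstar 𝔯 𝔢 𝔴 𝔈) x).GA 1 U (𝔬A x).blkY (𝔬A x).blk (evBK x.toKIdx) ((𝔬A x).D U ∘ₗ (𝔬A x).G U) := fun x U => by have h' := globReads_kernelFamilyB_coords_one x.toKIdx bK (bg9Y (Matrix (Fin N) (Fin N) ℂ) (specialUnitaryUnits (Fin N)) x) (fun U => U) (lettersYOfRecordV4 N θ.toStage3Params Mstar 𝔯 x).GA (lettersYOfRecordV4 N θ.toStage3Params Mstar 𝔯 x).parB U (hlev x); nth_rw 1 [← hblkYA x] at h'; rw [← hblkA x, ← hDcoA x U, ← hGcoA x U] at h'; exact h'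
  have hglA2 : ∀ (x : MemberY θ.d₆ θ.ℓ₆ θ.hd' θ.hL' θ.b₀ θ.b₁ Mstar) (U : (bg9Y (Matrix (Fin N) (Fin N) ℂ) (specialUnitaryUnits (Fin N)) x).Cfg), GlobReads ((opsYOfRecordV4E N θ.toStage3Params Mstar 𝔯 𝔢 𝔴 𝔈) x).GA 2 U (𝔬A x).blk (𝔬A x).blkY (evBK x.toKIdx) ((𝔬A x).G U ∘ₗ (𝔬A x).Dstar U) := fun x U => by have h' := globReads_kernelFamilyB_coords_two x.toKIdx bK (bg9Y (Matrix (Fin N) (Fin N) ℂ) (specialUnitaryUnits (Fin N)) x) (fun U => U) (lettersYOfRecordV4 N θ.toStage3Params Mstar 𝔯 x).GA (lettersYOfRecordV4 N θ.toStage3Params Mstar 𝔯 x).parB U (hlev x); nth_rw 2 [← hblkYA x] at h'; rw [← hblkA x, ← hDscoA x U, ← hGcoA x U] at h'; exact h'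
  have hglA3 : ∀ (x : MemberY θ.d₆ θ.ℓ₆ θ.hd' θ.hL' θ.b₀ θ.b₁ Mstar) (U : (bg9Y (Matrix (Fin N) (Fin N) ℂ) (specialUnitaryUnits (Fin N)) x).Cfg), GlobReads ((opsYOfRecordV4E N θ.toStage3Params Mstar 𝔯 𝔢 𝔴 𝔈) x).GA 3 U (𝔬A x).blk (𝔬A x).blk (evBK x.toKIdx) ((𝔬A x).Lap U ∘ₗ (𝔬A x).G U) := fun x U => by have h' := globReads_kernelFamilyB_coords_three x.toKIdx bK (bg9Y (Matrix (Fin N) (Fin N) ℂ) (specialUnitaryUnits (Fin N)) x) (fun U => U) (lettersYOfRecordV4 N θ.toStage3Params Mstar 𝔯 x).GA (lettersYOfRecordV4 N θ.toStage3Params Mstar 𝔯 x).parB U (hlev x); rw [← hblkA x, ← hLcoA x U, ← hGcoA x U] at h'; exact h'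
  have hRG0 : ∀ (x : MemberY θ.d₆ θ.ℓ₆ θ.hd' θ.hL' θ.b₀ θ.b₁ Mstar) (U : (bg9Y (Matrix (Fin N) (Fin N) ℂ) (specialUnitaryUnits (Fin N)) x).Cfg), CoRealizesRel ((opsYOfRecordV4E N θ.toStage3Params Mstar 𝔯 𝔢 𝔴 𝔈) x).GD 0 U (RelB x.toKIdx) (𝔬12 x).blk (𝔬12 x).blk (evBK x.toKIdx) ((𝔬12 x).G U) := fun x U => by have h' := coRealizesRel_kernelFamilyB_coords_zero x.toKIdx bK (bg9Y (Matrix (Fin N) (Fin N) ℂ) (specialUnitaryUnits (Fin N)) x) (fun U => U) (lettersYOfRecordV4 N θ.toStage3Params Mstar 𝔯 x).GD (lettersYOfRecordV4 N θ.toStage3Params Mstar 𝔯 x).parB U (hβI x); rw [← hblk12 x, ← hGco12 x U] at h'; exact h'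
  have hRG1 : ∀ (x : MemberY θ.d₆ θ.ℓ₆ θ.hd' θ.hL' θ.b₀ θ.b₁ Mstar) (U : (bg9Y (Matrix (Fin N) (Fin N) ℂ) (specialUnitaryUnits (Fin N)) x).Cfg), CoRealizesRel ((opsYOfRecordV4E N θ.toStage3Params Mstar 𝔯 𝔢 𝔴 𝔈) x).GD 1 U (RelB x.toKIdx) (𝔬12 x).blkY (𝔬12 x).blk (evBK x.toKIdx) ((𝔬12 x).D U ∘ₗ (𝔬12 x).G U) := fun x U => by have h' := coRealizesRel_kernelFamilyB_coords_one x.toKIdx bK (bg9Y (Matrix (Fin N) (Fin N) ℂ) (specialUnitaryUnits (Fin N)) x) (fun U => U) (lettersYOfRecordV4 N θ.toStage3Params Mstar 𝔯 x).GD (lettersYOfRecordV4 N θ.toStage3Params Mstar 𝔯 x).parB U (hβI x); nth_rw 1 [← hblkY12 x] at h'; rw [← hblk12 x, ← hDco12 x U, ← hGco12 x U] at h'; exact h'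
  have hRG2 : ∀ (x : MemberY θ.d₆ θ.ℓ₆ θ.hd' θ.hL' θ.b₀ θ.b₁ Mstar) (U : (bg9Y (Matrix (Fin N) (Fin N) ℂ) (specialUnitaryUnits (Fin N)) x).Cfg), CoRealizesRel ((opsYOfRecordV4E N θ.toStage3Params Mstar 𝔯 𝔢 𝔴 𝔈) x).GD 2 U (RelB x.toKIdx) (𝔬12 x).blk (𝔬12 x).blkY (evBK x.toKIdx) ((𝔬12 x).G U ∘ₗ (𝔬12 x).Dstar U) := fun x U => by have h' := coRealizesRel_kernelFamilyB_coords_two x.toKIdx bK (bg9Y (Matrix (Fin N) (Fin N) ℂ) (specialUnitaryUnits (Fin N)) x) (fun U => U) (lettersYOfRecordV4 N θ.toStage3Params Mstar 𝔯 x).GD (lettersYOfRecordV4 N θ.toStage3Params Mstar 𝔯 x).parB U (hβI x); nth_rw 2 [← hblkY12 x] at h'; rw [← hblk12 x, ← hDsco12 x U, ← hGco12 x U] at h'; exact h'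
  have hGG0 : ∀ (x : MemberY θ.d₆ θ.ℓ₆ θ.hd' θ.hL' θ.b₀ θ.b₁ Mstar) (U : (bg9Y (Matrix (Fin N) (Fin N) ℂ) (specialUnitaryUnits (Fin N)) x).Cfg), CoReadsGlob ((opsYOfRecordV4E N θ.toStage3Params Mstar 𝔯 𝔢 𝔴 𝔈) x).GD 0 U (𝔬12 x).blk (𝔬12 x).blk (evBK x.toKIdx) ((𝔬12 x).G U) := fun x U => by have h' := coReadsGlob_kernelFamilyB_coords_zero x.toKIdx bK (bg9Y (Matrix (Fin N) (Fin N) ℂ) (specialUnitaryUnits (Fin N)) x) (fun U => U) (lettersYOfRecordV4 N θ.toStage3Params Mstar 𝔯 x).GD (lettersYOfRecordV4 N θ.toStage3Params Mstar 𝔯 x).parB U (hlev x); rw [← hblk12 x, ← hGco12 x U] at h'; exact h'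
  have hGG1 : ∀ (x : MemberY θ.d₆ θ.ℓ₆ θ.hd' θ.hL' θ.b₀ θ.b₁ Mstar) (U : (bg9Y (Matrix (Fin N) (Fin N) ℂ) (specialUnitaryUnits (Fin N)) x).Cfg), CoReadsGlob ((opsYOfRecordV4E N θ.toStage3Params Mstar 𝔯 𝔢 𝔴 𝔈) x).GD 1 U (𝔬12 x).blkY (𝔬12 x).blk (evBK x.toKIdx) ((𝔬12 x).D U ∘ₗ (𝔬12 x).G U) := fun x U => by have h' := coReadsGlob_kernelFamilyB_coords_one x.toKIdx bK (bg9Y (Matrix (Fin N) (Fin N) ℂ) (specialUnitaryUnits (Fin N)) x) (fun U => U) (lettersYOfRecordV4 N θ.toStage3Params Mstar 𝔯 x).GD (lettersYOfRecordV4 N θ.toStage3Params Mstar 𝔯 x).parB U (hlev x); nth_rw 1 [← hblkY12 x] at h'; rw [← hblk12 x, ← hDco12 x U, ← hGco12 x U] at h'; exact h'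
  have hGG2 : ∀ (x : MemberY θ.d₆ θ.ℓ₆ θ.hd' θ.hL' θ.b₀ θ.b₁ Mstar) (U : (bg9Y (Matrix (Fin N) (Fin N) ℂ) (specialUnitaryUnits (Fin N)) x).Cfg), CoReadsGlob ((opsYOfRecordV4E N θ.toStage3Params Mstar 𝔯 𝔢 𝔴 𝔈) x).GD 2 U (𝔬12 x).blk (𝔬12 x).blkY (evBK x.toKIdx) ((𝔬12 x).G U ∘ₗ (𝔬12 x).Dstar U) := fun x U => by have h' := coReadsGlob_kernelFamilyB_coords_two x.toKIdx bK (bg9Y (Matrix (Fin N) (Fin N) ℂ) (specialUnitaryUnits (Fin N)) x) (fun U => U) (lettersYOfRecordV4 N θ.toStage3Params Mstar 𝔯 x).GD (lettersYOfRecordV4 N θ.toStage3Params Mstar 𝔯 x).parB U (hlev x); nth_rw 2 [← hblkY12 x] at h'; rw [← hblk12 x, ← hDsco12 x U, ← hGco12 x U] at h'; exact h'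
  have hRG10 : ∀ (x : MemberY θ.d₆ θ.ℓ₆ θ.hd' θ.hL' θ.b₀ θ.b₁ Mstar) (U : (bg9Y (Matrix (Fin N) (Fin N) ℂ) (specialUnitaryUnits (Fin N)) x).Cfg), CoRealizesRel ((opsYOfRecordV4E N θ.toStage3Params Mstar 𝔯 𝔢 𝔴 𝔈) x).G₁ 0 U (RelB x.toKIdx) (𝔬12 x).blk (𝔬12 x).blk (evBK x.toKIdx) ((𝔬12 x).G1 U) := fun x U => by have h' := coRealizesRel_kernelFamilyB_coords_zero x.toKIdx bK (bg9Y (Matrix (Fin N) (Fin N) ℂ) (specialUnitaryUnits (Fin N)) x) (fun U => U) (lettersYOfRecordV4 N θ.toStage3Params Mstar 𝔯 x).G₁ (lettersYOfRecordV4 N θ.toStage3Params Mstar 𝔯 x).parB U (hβI x); rw [← hblk12 x, ← hG1co12 x U] at h'; exact h'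
  have hRG11 : ∀ (x : MemberY θ.d₆ θ.ℓ₆ θ.hd' θ.hL' θ.b₀ θ.b₁ Mstar) (U : (bg9Y (Matrix (Fin N) (Fin N) ℂ) (specialUnitaryUnits (Fin N)) x).Cfg), CoRealizesRel ((opsYOfRecordV4E N θ.toStage3Params Mstar 𝔯 𝔢 𝔴 𝔈) x).G₁ 1 U (RelB x.toKIdx) (𝔬12 x).blkY (𝔬12 x).blk (evBK x.toKIdx) ((𝔬12 x).D U ∘ₗ (𝔬12 x).G1 U) := fun x U => by have h' := coRealizesRel_kernelFamilyB_coords_one x.toKIdx bK (bg9Y (Matrix (Fin N) (Fin N) ℂ) (specialUnitaryUnits (Fin N)) x) (fun U => U) (lettersYOfRecordV4 N θ.toStage3Params Mstar 𝔯 x).G₁ (lettersYOfRecordV4 N θ.toStage3Params Mstar 𝔯 x).parB U (hβI x); nth_rw 1 [← hblkY12 x] at h'; rw [← hblk12 x, ← hDco12 x U, ← hG1co12 x U] at h'; exact h'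
  have hRG12 : ∀ (x : MemberY θ.d₆ θ.ℓ₆ θ.hd' θ.hL' θ.b₀ θ.b₁ Mstar) (U : (bg9Y (Matrix (Fin N) (Fin N) ℂ) (specialUnitaryUnits (Fin N)) x).Cfg), CoRealizesRel ((opsYOfRecordV4E N θ.toStage3Params Mstar 𝔯 𝔢 𝔴 𝔈) x).G₁ 2 U (RelB x.toKIdx) (𝔬12 x).blk (𝔬12 x).blkY (evBK x.toKIdx) ((𝔬12 x).G1 U ∘ₗ (𝔬12 x).Dstar U) := fun x U => by have h' := coRealizesRel_kernelFamilyB_coords_two x.toKIdx bK (bg9Y (Matrix (Fin N) (Fin N) ℂ) (specialUnitaryUnits (Fin N)) x) (fun U => U) (lettersYOfRecordV4 N θ.toStage3Params Mstar 𝔯 x).G₁ (lettersYOfRecordV4 N θ.toStage3Params Mstar 𝔯 x).parB U (hβI x); nth_rw 2 [← hblkY12 x] at h'; rw [← hblk12 x, ← hDsco12 x U, ← hG1co12 x U] at h'; exact h'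
  have hGG10 : ∀ (x : MemberY θ.d₆ θ.ℓ₆ θ.hd' θ.hL' θ.b₀ θ.b₁ Mstar) (U : (bg9Y (Matrix (Fin N) (Fin N) ℂ) (specialUnitaryUnits (Fin N)) x).Cfg), CoReadsGlob ((opsYOfRecordV4E N θ.toStage3Params Mstar 𝔯 𝔢 𝔴 𝔈) x).G₁ 0 U (𝔬12 x).blk (𝔬12 x).blk (evBK x.toKIdx) ((𝔬12 x).G1 U) := fun x U => by have h' := coReadsGlob_kernelFamilyB_coords_zero x.toKIdx bK (bg9Y (Matrix (Fin N) (Fin N) ℂ) (specialUnitaryUnits (Fin N)) x) (fun U => U) (lettersYOfRecordV4 N θ.toStage3Params Mstar 𝔯 x).G₁ (lettersYOfRecordV4 N θ.toStage3Params Mstar 𝔯 x).parB U (hlev x); rw [← hblk12 x, ← hG1co12 x U] at h'; exact h'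
  have hGG11 : ∀ (x : MemberY θ.d₆ θ.ℓ₆ θ.hd' θ.hL' θ.b₀ θ.b₁ Mstar) (U : (bg9Y (Matrix (Fin N) (Fin N) ℂ) (specialUnitaryUnits (Fin N)) x).Cfg), CoReadsGlob ((opsYOfRecordV4E N θ.toStage3Params Mstar 𝔯 𝔢 𝔴 𝔈) x).G₁ 1 U (𝔬12 x).blkY (𝔬12 x).blk (evBK x.toKIdx) ((𝔬12 x).D U ∘ₗ (𝔬12 x).G1 U) := fun x U => by have h' := coReadsGlob_kernelFamilyB_coords_one x.toKIdx bK (bg9Y (Matrix (Fin N) (Fin N) ℂ) (specialUnitaryUnits (Fin N)) x) (fun U => U) (lettersYOfRecordV4 N θ.toStage3Params Mstar 𝔯 x).G₁ (lettersYOfRecordV4 N θ.toStage3Params Mstar 𝔯 x).parB U (hlev x); nth_rw 1 [← hblkY12 x] at h'; rw [← hblk12 x, ← hDco12 x U, ← hG1co12 x U] at h'; exact h'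
  have hGG12 : ∀ (x : MemberY θ.d₆ θ.ℓ₆ θ.hd' θ.hL' θ.b₀ θ.b₁ Mstar) (U : (bg9Y (Matrix (Fin N) (Fin N) ℂ) (specialUnitaryUnits (Fin N)) x).Cfg), CoReadsGlob ((opsYOfRecordV4E N θ.toStage3Params Mstar 𝔯 𝔢 𝔴 𝔈) x).G₁ 2 U (𝔬12 x).blk (𝔬12 x).blkY (evBK x.toKIdx) ((𝔬12 x).G1 U ∘ₗ (𝔬12 x).Dstar U) := fun x U => by have h' := coReadsGlob_kernelFamilyB_coords_two x.toKIdx bK (bg9Y (Matrix (Fin N) (Fin N) ℂ) (specialUnitaryUnits (Fin N)) x) (fun U => U) (lettersYOfRecordV4 N θ.toStage3Params Mstar 𝔯 x).G₁ (lettersYOfRecordV4 N θ.toStage3Params Mstar 𝔯 x).parB U (hlev x); nth_rw 2 [← hblkY12 x] at h'; rw [← hblk12 x, ← hDsco12 x U, ← hG1co12 x U] at h'; exact h'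
  have hRGG0 : ∀ (x : MemberY θ.d₆ θ.ℓ₆ θ.hd' θ.hL' θ.b₀ θ.b₁ Mstar) (U : (bg9Y (Matrix (Fin N) (Fin N) ℂ) (specialUnitaryUnits (Fin N)) x).Cfg), CoRealizesRel ((opsYOfRecordV4E N θ.toStage3Params Mstar 𝔯 𝔢 𝔴 𝔈) x).GG 0 U (RelB x.toKIdx) (𝔬12 x).blk (𝔬12 x).blk (evBK x.toKIdx) ((𝔬12 x).GG U) := fun x U => by have h' := coRealizesRel_kernelFamilyB_coords_zero x.toKIdx bK (bg9Y (Matrix (Fin N) (Fin N) ℂ) (specialUnitaryUnits (Fin N)) x) (fun U => U) (lettersYOfRecordV4 N θ.toStage3Params Mstar 𝔯 x).GG (lettersYOfRecordV4 N θ.toStage3Params Mstar 𝔯 x).parB U (hβI x); rw [← hblk12 x, ← hGGco12 x U] at h'; exact h'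
  have hRGG1 : ∀ (x : MemberY θ.d₆ θ.ℓ₆ θ.hd' θ.hL' θ.b₀ θ.b₁ Mstar) (U : (bg9Y (Matrix (Fin N) (Fin N) ℂ) (specialUnitaryUnits (Fin N)) x).Cfg), CoRealizesRel ((opsYOfRecordV4E N θ.toStage3Params Mstar 𝔯 𝔢 𝔴 𝔈) x).GG 1 U (RelB x.toKIdx) (𝔬12 x).blkY (𝔬12 x).blk (evBK x.toKIdx) ((𝔬12 x).D U ∘ₗ (𝔬12 x).GG U) := fun x U => by have h' := coRealizesRel_kernelFamilyB_coords_one x.toKIdx bK (bg9Y (Matrix (Fin N) (Fin N) ℂ) (specialUnitaryUnits (Fin N)) x) (fun U => U) (lettersYOfRecordV4 N θ.toStage3Params Mstar 𝔯 x).GG (lettersYOfRecordV4 N θ.toStage3Params Mstar 𝔯 x).parB U (hβI x); nth_rw 1 [← hblkY12 x] at h'; rw [← hblk12 x, ← hDco12 x U, ← hGGco12 x U] at h'; exact h'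
  have hRGG2 : ∀ (x : MemberY θ.d₆ θ.ℓ₆ θ.hd' θ.hL' θ.b₀ θ.b₁ Mstar) (U : (bg9Y (Matrix (Fin N) (Fin N) ℂ) (specialUnitaryUnits (Fin N)) x).Cfg), CoRealizesRel ((opsYOfRecordV4E N θ.toStage3Params Mstar 𝔯 𝔢 𝔴 𝔈) x).GG 2 U (RelB x.toKIdx) (𝔬12 x).blk (𝔬12 x).blkY (evBK x.toKIdx) ((𝔬12 x).GG U ∘ₗ (𝔬12 x).Dstar U) := fun x U => by have h' := coRealizesRel_kernelFamilyB_coords_two x.toKIdx bK (bg9Y (Matrix (Fin N) (Fin N) ℂ) (specialUnitaryUnits (Fin N)) x) (fun U => U) (lettersYOfRecordV4 N θ.toStage3Params Mstar 𝔯 x).GG (lettersYOfRecordV4 N θ.toStage3Params Mstar 𝔯 x).parB U (hβI x); nth_rw 2 [← hblkY12 x] at h'; rw [← hblk12 x, ← hDsco12 x U, ← hGGco12 x U] at h'; exact h'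
  have hGGG0 : ∀ (x : MemberY θ.d₆ θ.ℓ₆ θ.hd' θ.hL' θ.b₀ θ.b₁ Mstar) (U : (bg9Y (Matrix (Fin N) (Fin N) ℂ) (specialUnitaryUnits (Fin N)) x).Cfg), CoReadsGlob ((opsYOfRecordV4E N θ.toStage3Params Mstar 𝔯 𝔢 𝔴 𝔈) x).GG 0 U (𝔬12 x).blk (𝔬12 x).blk (evBK x.toKIdx) ((𝔬12 x).GG U) := fun x U => by have h' := coReadsGlob_kernelFamilyB_coords_zero x.toKIdx bK (bg9Y (Matrix (Fin N) (Fin N) ℂ) (specialUnitaryUnits (Fin N)) x) (fun U => U) (lettersYOfRecordV4 N θ.toStage3Params Mstar 𝔯 x).GG (lettersYOfRecordV4 N θ.toStage3Params Mstar 𝔯 x).parB U (hlev x); rw [← hblk12 x, ← hGGco12 x U] at h'; exact h'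
  have hGGG1 : ∀ (x : MemberY θ.d₆ θ.ℓ₆ θ.hd' θ.hL' θ.b₀ θ.b₁ Mstar) (U : (bg9Y (Matrix (Fin N) (Fin N) ℂ) (specialUnitaryUnits (Fin N)) x).Cfg), CoReadsGlob ((opsYOfRecordV4E N θ.toStage3Params Mstar 𝔯 𝔢 𝔴 𝔈) x).GG 1 U (𝔬12 x).blkY (𝔬12 x).blk (evBK x.toKIdx) ((𝔬12 x).D U ∘ₗ (𝔬12 x).GG U) := fun x U => by have h' := coReadsGlob_kernelFamilyB_coords_one x.toKIdx bK (bg9Y (Matrix (Fin N) (Fin N) ℂ) (specialUnitaryUnits (Fin N)) x) (fun U => U) (lettersYOfRecordV4 N θ.toStage3Params Mstar 𝔯 x).GG (lettersYOfRecordV4 N θ.toStage3Params Mstar 𝔯 x).parB U (hlev x); nth_rw 1 [← hblkY12 x] at h'; rw [← hblk12 x, ← hDco12 x U, ← hGGco12 x U] at h'; exact h'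
  have hGGG2 : ∀ (x : MemberY θ.d₆ θ.ℓ₆ θ.hd' θ.hL' θ.b₀ θ.b₁ Mstar) (U : (bg9Y (Matrix (Fin N) (Fin N) ℂ) (specialUnitaryUnits (Fin N)) x).Cfg), CoReadsGlob ((opsYOfRecordV4E N θ.toStage3Params Mstar 𝔯 𝔢 𝔴 𝔈) x).GG 2 U (𝔬12 x).blk (𝔬12 x).blkY (evBK x.toKIdx) ((𝔬12 x).GG U ∘ₗ (𝔬12 x).Dstar U) := fun x U => by have h' := coReadsGlob_kernelFamilyB_coords_two x.toKIdx bK (bg9Y (Matrix (Fin N) (Fin N) ℂ) (specialUnitaryUnits (Fin N)) x) (fun U => U) (lettersYOfRecordV4 N θ.toStage3Params Mstar 𝔯 x).GG (lettersYOfRecordV4 N θ.toStage3Params Mstar 𝔯 x).parB U (hlev x); nth_rw 2 [← hblkY12 x] at h'; rw [← hblk12 x, ← hDsco12 x U, ← hGGco12 x U] at h'; exact h'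
  have hcoR12 := fun (x : MemberY θ.d₆ θ.ℓ₆ θ.hd' θ.hL' θ.b₀ θ.b₁ Mstar) (U : (bg9Y (Matrix (Fin N) (Fin N) ℂ) (specialUnitaryUnits (Fin N)) x).Cfg) => And.intro (hRG0 x U) (And.intro (hRG2 x U) (And.intro (hRG10 x U) (hRG12 x U)))
  have hco1R12 := fun (x : MemberY θ.d₆ θ.ℓ₆ θ.hd' θ.hL' θ.b₀ θ.b₁ Mstar) (U : (bg9Y (Matrix (Fin N) (Fin N) ℂ) (specialUnitaryUnits (Fin N)) x).Cfg) => And.intro (hRG1 x U) (hRG11 x U)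
  have hcoG12 := fun (x : MemberY θ.d₆ θ.ℓ₆ θ.hd' θ.hL' θ.b₀ θ.b₁ Mstar) (U : (bg9Y (Matrix (Fin N) (Fin N) ℂ) (specialUnitaryUnits (Fin N)) x).Cfg) => And.intro (hGG0 x U) (And.intro (hGG1 x U) (And.intro (hGG2 x U) (And.intro (hGG10 x U) (And.intro (hGG11 x U) (hGG12 x U)))))
  have hcoR13 := fun (x : MemberY θ.d₆ θ.ℓ₆ θ.hd' θ.hL' θ.b₀ θ.b₁ Mstar) (U : (bg9Y (Matrix (Fin N) (Fin N) ℂ) (specialUnitaryUnits (Fin N)) x).Cfg) => And.intro (hRGG0 x U) (hRGG2 x U)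
  have hco1R13 := fun (x : MemberY θ.d₆ θ.ℓ₆ θ.hd' θ.hL' θ.b₀ θ.b₁ Mstar) (U : (bg9Y (Matrix (Fin N) (Fin N) ℂ) (specialUnitaryUnits (Fin N)) x).Cfg) => hRGG1 x U
  have hcoG13 := fun (x : MemberY θ.d₆ θ.ℓ₆ θ.hd' θ.hL' θ.b₀ θ.b₁ Mstar) (U : (bg9Y (Matrix (Fin N) (Fin N) ℂ) (specialUnitaryUnits (Fin N)) x).Cfg) => And.intro (hGGG0 x U) (And.intro (hGGG1 x U) (hGGG2 x U))
  have s349 : B9.Stmt349Printed (θ.d₆ + 1) c35Y geo9Y (bg9Y (Matrix (Fin N) (Fin N) ℂ) (specialUnitaryUnits (Fin N))) (fun x => ((opsYOfRecordV4E N θ.toStage3Params Mstar 𝔯 𝔢 𝔴 𝔈) x).P349) :=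
    stmt349Printed_site_of_blockSchemas (lettersYOfRecordV4 N θ.toStage3Params Mstar 𝔯) h31S h32B
  have hRd₂ : ∀ (x : MemberY θ.d₆ θ.ℓ₆ θ.hd' θ.hL' θ.b₀ θ.b₁ Mstar) (a b b' : (geo9Y x).Site), RelB x.toKIdx b b' → (geo9Y x).dist a b = (geo9Y x).dist a b' :=
    fun x a b b' h => dist_eq_of_relB x.toKIdx (relB_refl x.toKIdx a) h
  obtain ⟨t37', c38', t310', hsum'⟩ := rows131819_definite_geo9Y_nbr (bg := bg9Y (Matrix (Fin N) (Fin N) ℂ) (specialUnitaryUnits (Fin N))) p q hp hq c35Y_pos H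
    (fun x => RelB x.toKIdx) (2 * (θ.d₆ + 1)) mN Cev hCev hRlen hRdist hRd₂ hmult hnbr 𝔬 rd 𝔭 bH (fun x => ((opsYOfRecordV4E N θ.toStage3Params Mstar 𝔯 𝔢 𝔴 𝔈) x).Gp) (fun x => evSK x.toKIdx) (fun x => evSK x.toKIdx) κ SH SL SI S2 hst hκ hrd hloc h36 h36H
    hco0 hco1 hco2 hco3 hgl0 hgl1 hgl2 hgl3 hl0 hl1 hl2 hl3 hl4 hl5 hH1 hIR hsym htr hadjL hcntH hcntL hcntI hcnt2 𝔬A rdA 𝔭A bHA (fun x => ((opsYOfRecordV4E N θ.toStage3Params Mstar 𝔯 𝔢 𝔴 𝔈) x).GA) (fun x => evBK x.toKIdx) (fun x => evBK x.toKIdx)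
    κA SHA SLA SIA S2A hstA hκA hrdA hlocA h36A h36HA hcoA0 hcoA1 hcoA2 hcoA3 hglA0 hglA1 hglA2 hglA3 hlA0 hlA1 hlA2 hlA3 hlA4 hlA5 hH1A hIRA hsymA htrA hadjLA
    hcntHA hcntLA hcntIA hcnt2A
  have h37f : (fun x => ((opsYOfRecordV4E N θ.toStage3Params Mstar 𝔯 𝔢 𝔴 𝔈) x).E37) = fun x => E37YNbr (bg := bg9Y (Matrix (Fin N) (Fin N) ℂ) (specialUnitaryUnits (Fin N))) (2 * (θ.d₆ + 1)) mN Cev p q (𝔬 x) (rd x) (H x)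
      ((opsYOfRecordV4E N θ.toStage3Params Mstar 𝔯 𝔢 𝔴 𝔈) x).Gp := funext hE37
  have h310f : (fun x => ((opsYOfRecordV4E N θ.toStage3Params Mstar 𝔯 𝔢 𝔴 𝔈) x).E310) = fun x => E310YNbr (bg := bg9Y (Matrix (Fin N) (Fin N) ℂ) (specialUnitaryUnits (Fin N))) (2 * (θ.d₆ + 1)) mN Cev p q (𝔬A x) (rdA x) (H x)
      ((opsYOfRecordV4E N θ.toStage3Params Mstar 𝔯 𝔢 𝔴 𝔈) x).GA := funext hE310
  have t37 : B9.Thm37Printed c35Y geo9Y (bg9Y (Matrix (Fin N) (Fin N) ℂ) (specialUnitaryUnits (Fin N))) (fun x => ((opsYOfRecordV4E N θ.toStage3Params Mstar 𝔯 𝔢 𝔴 𝔈) x).E37) := h37f ▸ t37'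
  have c38 : B9.Cor38Printed c35Y geo9Y (bg9Y (Matrix (Fin N) (Fin N) ℂ) (specialUnitaryUnits (Fin N))) (fun x => ((opsYOfRecordV4E N θ.toStage3Params Mstar 𝔯 𝔢 𝔴 𝔈) x).E37) := h37f ▸ c38'
  have t310 : B9.Thm310Printed c35Y geo9Y (bg9Y (Matrix (Fin N) (Fin N) ℂ) (specialUnitaryUnits (Fin N))) (fun x => ((opsYOfRecordV4E N θ.toStage3Params Mstar 𝔯 𝔢 𝔴 𝔈) x).E310) := h310f ▸ t310'
  have hsum : B9.RWSumsYieldIneqs geo9Y (bg9Y (Matrix (Fin N) (Fin N) ℂ) (specialUnitaryUnits (Fin N))) (fun x => ((opsYOfRecordV4E N θ.toStage3Params Mstar 𝔯 𝔢 𝔴 𝔈) x).E37) (fun x => ((opsYOfRecordV4E N θ.toStage3Params Mstar 𝔯 𝔢 𝔴 𝔈) x).E310)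
      (fun x => ((opsYOfRecordV4E N θ.toStage3Params Mstar 𝔯 𝔢 𝔴 𝔈) x).Gp) (fun x => ((opsYOfRecordV4E N θ.toStage3Params Mstar 𝔯 𝔢 𝔴 𝔈) x).GA) := by
    rw [h37f, h310f]; exact hsum'
  have h32 := B9.thm32_of_thm39 (θ.d₆ + 1) c35Y geo9Y (bg9Y (Matrix (Fin N) (Fin N) ℂ) (specialUnitaryUnits (Fin N))) (fun x => ((opsYOfRecordV4E N θ.toStage3Params Mstar 𝔯 𝔢 𝔴 𝔈) x).EK39) (fun x => ((opsYOfRecordV4E N θ.toStage3Params Mstar 𝔯 𝔢 𝔴 𝔈) x).Cinv) t39 hksum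
  have h33 := B9.thm33_of_thm37_310 c35Y geo9Y (bg9Y (Matrix (Fin N) (Fin N) ℂ) (specialUnitaryUnits (Fin N))) (fun x => ((opsYOfRecordV4E N θ.toStage3Params Mstar 𝔯 𝔢 𝔴 𝔈) x).E37) (fun x => ((opsYOfRecordV4E N θ.toStage3Params Mstar 𝔯 𝔢 𝔴 𝔈) x).E310) (fun x => ((opsYOfRecordV4E N θ.toStage3Params Mstar 𝔯 𝔢 𝔴 𝔈) x).Gp)
    (fun x => ((opsYOfRecordV4E N θ.toStage3Params Mstar 𝔯 𝔢 𝔴 𝔈) x).GA) t37 t310 hsum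
  have hB := hB_obligation_of_sectBFrame₃ θ.toStage3Params Mstar (opsYOfRecordV4E N θ.toStage3Params Mstar 𝔯 𝔢 𝔴 𝔈) bB SB F hdB h32 h33
  have hgeoOK : ∀ x : MemberY θ.d₆ θ.ℓ₆ θ.hd' θ.hL' θ.b₀ θ.b₁ Mstar, GeoOK (geo9Y x) := fun x => ⟨geo9Y_dist_triangle x, geo9Y_dist_comm x, geo9K_dist_nonneg x.toKIdx, geo9Y_len_pos x⟩
  obtain ⟨ML12, c12, hrow12⟩ := rowSum261_geo9Y (d := θ.d₆) (ℓ := θ.ℓ₆) (hd := θ.hd') (hL := θ.hL') (b₀ := θ.b₀) (b₁ := θ.b₁) (Mstar := Mstar) σ12 hσ12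
  have hrow : ∀ x : MemberY θ.d₆ θ.ℓ₆ θ.hd' θ.hL' θ.b₀ θ.b₁ Mstar, ML12 ≤ (geo9Y x).M → RowSum (toB6 (geo9Y x) 1 (H12 x)) σ12 (max c12 0) := fun x hM y => (hrow12 x hM y).trans (le_max_left _ _)
  have hE : (fun x => ((opsYOfRecordV4E N θ.toStage3Params Mstar 𝔯 𝔢 𝔴 𝔈) x).HasRWExp) = fun x => HasRWExpOfOps (𝔬12 x) := funext hpinE
  have hH : (fun x => ((opsYOfRecordV4E N θ.toStage3Params Mstar 𝔯 𝔢 𝔴 𝔈) x).HasRWExpH) = fun x => HasRWExpHOfOps (𝔬12 x) := funext hpinH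
  have hK' : (fun x => ((opsYOfRecordV4E N θ.toStage3Params Mstar 𝔯 𝔢 𝔴 𝔈) x).PosDefK) = fun x => PosDefKOfOps (𝔬12 x) := funext hpinK
  have hη : ∀ x : MemberY θ.d₆ θ.ℓ₆ θ.hd' θ.hL' θ.b₀ θ.b₁ Mstar, 0 < (geo9Y x).eta := fun x => (distOK_geo9Y x).eta_pos
  have hL21 := lemma21AboveG_geo9Y (d := θ.d₆) (ℓ := θ.ℓ₆) (hd := θ.hd') (hL := θ.hL') (b₀ := θ.b₀) (b₁ := θ.b₁) (Mstar := Mstar) H12 hα12 (hα12'.trans_lt one_half_lt_one)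
  have t312 : B9.Thm312Printed (θ.d₆ + 1) c35Y geo9Y (bg9Y (Matrix (Fin N) (Fin N) ℂ) (specialUnitaryUnits (Fin N))) (fun x => ((opsYOfRecordV4E N θ.toStage3Params Mstar 𝔯 𝔢 𝔴 𝔈) x).GD) (fun x => ((opsYOfRecordV4E N θ.toStage3Params Mstar 𝔯 𝔢 𝔴 𝔈) x).G₁)
      (fun x => ((opsYOfRecordV4E N θ.toStage3Params Mstar 𝔯 𝔢 𝔴 𝔈) x).H) (fun x => ((opsYOfRecordV4E N θ.toStage3Params Mstar 𝔯 𝔢 𝔴 𝔈) x).H₁) (fun x => ((opsYOfRecordV4E N θ.toStage3Params Mstar 𝔯 𝔢 𝔴 𝔈) x).HasRWExp) (fun x => ((opsYOfRecordV4E N θ.toStage3Params Mstar 𝔯 𝔢 𝔴 𝔈) x).HasRWExpH)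
      (fun x => ((opsYOfRecordV4E N θ.toStage3Params Mstar 𝔯 𝔢 𝔴 𝔈) x).PosDefK) := by
    rw [hE, hH, hK']
    exact thm312Printed_of_stepRelH 𝔬12 (fun _ => 1) H12 (fun x => ((opsYOfRecordV4E N θ.toStage3Params Mstar 𝔯 𝔢 𝔴 𝔈) x).GD) (fun x => ((opsYOfRecordV4E N θ.toStage3Params Mstar 𝔯 𝔢 𝔴 𝔈) x).G₁) (fun x => ((opsYOfRecordV4E N θ.toStage3Params Mstar 𝔯 𝔢 𝔴 𝔈) x).H)
      (fun x => ((opsYOfRecordV4E N θ.toStage3Params Mstar 𝔯 𝔢 𝔴 𝔈) x).H₁) (fun x => evBK x.toKIdx) (fun x => evBK x.toKIdx) (fun x => RelB x.toKIdx) (2 * (θ.d₆ + 1)) θ12 θD12 r12 B12₀ δ12₀ δK12 σ12 (max c12 0) ρ12 a12 M12 ML12 B12₁ δ12₁ B12₃ δ12₃ α12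
      ((θ.ℓ₆ + 1 : ℕ) : ℝ) Bβ12 Bε12 Bεβ12 hθ12 hθD12 hr12 hB12₀ hB12₃ hσ12.le hρ12 hρS12 hρδ12 hρ₃12 (le_max_right _ _) ha12 hM12 hδ12₁ hα12' hBβ12 hBε12 hBεβ12 hgeoOK
      (fun x => modelSignsOn_geo9K x.toKIdx) (fun _ => hL1) (fun _ => le_rfl) hη hrow hL21 hsat hmult hRdist hRlen hcoR12 hco1R12 hcoHR12 hcoG12 hmodel12 hleft12 hlettersH12 hres12
  have t313 : B9.Thm313Printed c35Y geo9Y (bg9Y (Matrix (Fin N) (Fin N) ℂ) (specialUnitaryUnits (Fin N))) (fun x => ((opsYOfRecordV4E N θ.toStage3Params Mstar 𝔯 𝔢 𝔴 𝔈) x).GG) (fun x => ((opsYOfRecordV4E N θ.toStage3Params Mstar 𝔯 𝔢 𝔴 𝔈) x).HasRWExp) (fun x => ((opsYOfRecordV4E N θ.toStage3Params Mstar 𝔯 𝔢 𝔴 𝔈) x).PosDefK) := by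
    rw [hE, hK']
    exact thm313Printed_of_stepRel 𝔬12 (fun _ => 1) H12 (fun x => ((opsYOfRecordV4E N θ.toStage3Params Mstar 𝔯 𝔢 𝔴 𝔈) x).GG) bH13 (fun x => evBK x.toKIdx) (fun x => evBK x.toKIdx) (fun x => RelB x.toKIdx) (2 * (θ.d₆ + 1)) θ12 θD12 r12 B12₀ δ12₀ δK12 σ12 (max c12 0) ρ12 a12 M12 ML12
      B12₁ δ12₁ B12₃ δ12₃ ρ13 α12 ((θ.ℓ₆ + 1 : ℕ) : ℝ) κ13 Bβ12 Bε12 Bεβ12 hθ12 hθD12 hr12 hB12₀ hB12₃ hσ12.le hρ13 hρ13ρ hρS12 (le_trans (by linarith only [hσ12]) hρ₃12) hρδ12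
      (le_max_right _ _) ha12 hM12 hδ12₁ hBβ12 hBε12 hBεβ12 hgeoOK (fun x => modelSignsOn_geo9K x.toKIdx) (fun _ => hL1) (fun _ => le_rfl) hη hκ13 hrow hL21 hsat hmult hcoR13 hco1R13 hcoG13
      hmodel12 hleft12 hletters13 hlettersD13 hres13
  have hE4 := hE4_of_hGA_e4 (opsYOfRecordV4E N θ.toStage3Params Mstar 𝔯 𝔢 𝔴 𝔈) (hGA_e4_opsYOfLetters N θ.toStage3Params Mstar (lettersYOfRecordV4 N θ.toStage3Params Mstar 𝔯) 𝔈)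
  have hH2 := hH2_of_hGA_h2 (opsYOfRecordV4E N θ.toStage3Params Mstar 𝔯 𝔢 𝔴 𝔈) (hGA_h2_opsYOfLetters N θ.toStage3Params Mstar (lettersYOfRecordV4 N θ.toStage3Params Mstar 𝔯) 𝔈)
  have hg := hg_obligation_vacuous θ.toStage3Params Mstar (opsYOfRecordV4E N θ.toStage3Params Mstar 𝔯 𝔢 𝔴 𝔈)
  exact b9_main_of_up_view₁₁B10YZW_of_obligations θ hθ Mstar (opsYOfRecordV4E N θ.toStage3Params Mstar 𝔯 𝔢 𝔴 𝔈) ζ lamW w hup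
    (hGp_e_opsYOfLetters N θ.toStage3Params Mstar (lettersYOfRecordV4 N θ.toStage3Params Mstar 𝔯) 𝔈) (hGp_h1_opsYOfLetters N θ.toStage3Params Mstar (lettersYOfRecordV4 N θ.toStage3Params Mstar 𝔯) 𝔈)
    (hC_opsYOfLetters N θ.toStage3Params Mstar (lettersYOfRecordV4 N θ.toStage3Params Mstar 𝔯) 𝔈) (hGA_e_opsYOfLetters N θ.toStage3Params Mstar (lettersYOfRecordV4 N θ.toStage3Params Mstar 𝔯) 𝔈)
    (hGA_h1_opsYOfLetters N θ.toStage3Params Mstar (lettersYOfRecordV4 N θ.toStage3Params Mstar 𝔯) 𝔈) (hGA_e4_opsYOfLetters N θ.toStage3Params Mstar (lettersYOfRecordV4 N θ.toStage3Params Mstar 𝔯) 𝔈)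
    (hGA_h2_opsYOfLetters N θ.toStage3Params Mstar (lettersYOfRecordV4 N θ.toStage3Params Mstar 𝔯) 𝔈) (hGA_l2_opsYOfLetters N θ.toStage3Params Mstar (lettersYOfRecordV4 N θ.toStage3Params Mstar 𝔯) 𝔈)
    hE4 hH2 hGp hGA hB hg t37 c38 t39 t310 hsum hksum t311 t312 t313 t314 t315 s349 s3132 t314loc P

end Pointed

end Summit.QuantumFields.YangMills.BalabanUVNodes.N06AtOpsYOfRecordV4ECoordsS

end
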